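import Literature.MathematicalPhysics.QuantumFieldTheory.Balaban1983to89.B7Prop4Flat
import Literature.MathematicalPhysics.QuantumFieldTheory.Balaban1983to89.B7Prop1Local
import Literature.MathematicalPhysics.QuantumFieldTheory.Balaban1983to89.B7Ineq148

/-!
# Bałaban's renormalization group for 4-d lattice Yang–Mills — B7 Proposition 5 (137)–(157) AT THE FLAT BACKGROUND
`U₀ = 1`: the functional derivative (137)/(138) of the remainders `C_j(U₀, A)` (134) in the direction of ONE bond
variable, the recursion (152), the (149)–(155) induction with the explicit witnesses `C″₁(d, L) = 4C₁(d)L^{d+2}` for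
(148) (pv23's `B7Ineq148.ineq148Printed_of_123` fed with Prop. 3 at `V₀ = 1`) and `C₃(d, L) = 128(d+1)C₁(d)L^d`, and
PROPOSITION 5 at `U₀ = 1`: (157) `|δ/δA_b C_k(U₀, A, c)| ≤ C₃|A|`, (156) `|δ/δA_b Q_k(U₀, ηA, c)| ≤ 1 + C₃|A|`, for
`C₃|A| ≤ 1`, UNIFORMLY IN `k` (and in `η = L^{−k}`), together with the locality "`b ⊂ B^k(c₋) ∪ B^k(c₊)`" of the
derivative (`B7Prop5Flat`)

CITATION HEADER (lean-in-tree rule 2026-08-18).  Audit cell `pub-balaban`, paper sub-cell B07 (unit b2b-balaban-b07,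
gen 18).  Source: T. Bałaban, *Averaging operations for lattice gauge theories*, Commun. Math. Phys. **98**, 17–51
(1985) [Balaban1985Averaging] (cell paper B7; journal page = PDF page + 16), Sect. D pp. 39–42 [PDF 23–26], quoted from
the page renders `b2b-balaban-ref1/pages/1985-cmp98-averaging/1985-cmp98-averaging-p023-x2.png`, `-p024-x2.png`,
`-p025-x2.png`, `-p026-x2.png` READ AS IMAGES (2026-08-19); the sentences of p. 24 [PDF 8] (locality, after (43)),
p. 31 (after (91)), p. 34, pp. 36–38 ((122)–(135), Prop. 4) quoted in docstrings below are carried VERBATIM from the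
headers of `B7Prop1Local`, `B7Prop3Flat`, `B7Prop4Flat` (same lineage; renders `-p008-x2.png`, `-p015-x2.png`,
`-p018-x2.png`, `-p020-x2.png`–`-p022-x2.png` read as images there, 2026-08-18/19).
Companions (all imported, all REUSED by name, none restated): `B7Prop3Flat` (the one-step objects at `V₀ = 1`:
`dbavg` (89), `linQ = L·Q₀` (122)/(125), `expCfg`, `insCfg`, `C1 = 1256(d+1)²`, `c3 = 1/(128(d+1)L)`, Prop. 3 at
`V₀ = 1` incl. the analyticity `prop3_flat_C_ins`), `B7Prop4Flat` (`logIter` = `Q_j(1, ·)`, `linQIter` = `L^jη·Q_j(1)`,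
`prop3_flat_global`, `prop4_flat_induction` (130)/(131), `linQ_sub`, `norm_linQIter_le`), `B7Prop1Local` (boxes
`InBox`/`AgreeOn`/`bondHi`/`loK`/`bondHiK` and the locality of the tree-path average `bavg_congr`), `B7Ineq148` (pv23:
`dPair` = (137) along complex lines, `Qpp` = `Q″` (140) on a finite bond set, `Ineq148Printed` = the shape of (148),
`ineq148Printed_of_123` = (148) from analyticity + (123) by a Cauchy estimate), `B7Prop1Explicit` (`Site = ℤ^d`, `e`,
`seg`, `asum`, `boxVec`), `MatrixLog` (`mlog`, the series (21)).  NOT imported: `B7` (the quoted leaf `B7.Prop5Printed`,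
curved background, untouched — see ABSOLUTE-RULE LEDGER), `B7Prop5Induction` (pv19: the operator-chain inductions
(143)/(149) with (135)/(148) as HYPOTHESES; the present file proves the flat case for the concrete objects instead).

THE PRINTED TEXT.  p. 39: "We will need some more precise information about the function Q_k. This information is
connected with a notion of the functional derivative. Let us recall this notion. If F(A) is a differentiable function
defined at field configurations A on Ω, then the differential dF(A, δA) = (d/dt) F(A + tδA)|_{t=0} (137) is a linear
functional of the variable δA and can be represented as a scalar product of δA and some Lie algebra valued function.
This function is called the functional derivative and is denoted by (δ/δA) F(A), thus we have (d/dt) F(A + tδA)|_{t=0}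
= Σ_{b⊂Ω} η^d tr (δF(A)/δA_b) δA_b = ⟨δF(A)/δA, δA⟩. (138) From this definition it follows easily that the functional
derivative coincides with partial derivatives (gradient) of F(A) multiplied by η^{−d}. We would like to prove that the
functional derivative of Q_k(U₀, ηA) is bounded by a constant independent of η. This property is not clear even for
the linear part of Q_k, so let us start with an analysis of this linear part. The linear part of the one-step
renormalization transformation is given by the formula (124). It is a sum of the main term Q_{V₀}A given by (125) and
a remainder which we will denote by Q″(V₀)A. From (124) it is clear that we have the inequalities |Q_{V₀}A| ≤ Q|A|,
|Q″(V₀)A| ≤ C′₁L²α₀Q″|A|, (139) where the operator Q is defined as in [2], and Q″ is defined as (Q″A)_c =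
Σ_{b⊂B(c₋)∪B(c₊)} L^{−d}A_b. (140) The constant C′₁ depends on d and L. A composition of k operators Q is the operator
Q_k. The operators Q″ do not compose in a simple way, but if we introduce an operator Q″_k by the formula (Q″_kA)_c =
Σ_{b⊂B^k(c₋)∪B^k(c₊)} η^dA_b, c ⊂ Ω^{(k)}, (141) then we have the inequality |Q″Q″_jA| ≤ Q″Q″_j|A| ≤ 2dQ″_{j+1}|A|.
(142)"  p. 40: "For j = k we have |Q_k(U₀)A| ≤ Q_k|A| + 2C′₁α₀Q″_k|A| ≤ (1 + 2C′₁α₀)Q″_k|A|, (146) and this bound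
implies the required property, namely (δ/δA_b)(Q_k(U₀)A)_c = Q_k(U₀; c, b), |Q_k(U₀; c, b)| ≤ 1 + 2C′₁α₀. (147) Now we
will generalize it to the whole function Q_k. It is enough to prove it for C_k. For one-step renormalization
transformation we have the bound |⟨δC(V₀, A)/δA, δA⟩| ≤ C″₁|A|Q″|δA| (148) following easily from general properties
of the function C(V₀, A). The constant C″₁ depends on d and L. We will prove that a similar bound holds for the
functional derivative of C_j(U₀, A) for arbitrary j ≤ k. We will prove by induction that |⟨(δ/δA) C_j(U₀, A), δA⟩|
≤ C₃|A|Q″_j|δA|, (149) where the configurations A are considered on L^{−j}-lattice and C₃ is a positive constant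
satisfying conditions which will be written later. From the definition of the functions Q_j(U₀, ηA) we have
Q_{j+1}(U₀, ηA) = Q(Ū₀^j, Q_j(U₀, ηA)), Q_j(U₀, ηA) = L^jηQ_j(U₀)A + C_j(U₀, L^jηA), (150) hence Q_{j+1}(U₀, ηA) =
LQ(Ū₀^j)Q_j(U₀, ηA) + C(Ū₀^j, Q_j(U₀, ηA)) = L^{j+1}ηQ(Ū₀^j)Q_j(U₀)A + LQ(Ū₀^j)C_j(U₀, L^jηA) + C(Ū₀^j, Q_j(U₀, ηA)) =
L^{j+1}ηQ_{j+1}(U₀)A + C_{j+1}(U₀, L^{j+1}ηA), (151)"  p. 41: "and C_{j+1}(U₀, A) = LQ(Ū₀^j)C_j(U₀, L^{−1}A) +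
C(Ū₀^j, L^{−1}Q_j(U₀)A + C_j(U₀, L^{−1}A)), (152) A is a field configuration considered on L^{−(j+1)}Z^d, |A| <
L^{j+1}ηα₁. Differentiation of the above equality gives ⟨(δ/δA) C_{j+1}(U₀, A), δA⟩ = Q(Ū₀^j)⟨(δC_j/δA)(U₀, L^{−1}A),
δA⟩ + ⟨(δC/δA)(Ū₀^j, L^{−1}Q_j(U₀)A + C_j(U₀, L^{−1}A)), L^{−1}Q_j(U₀)δA + L^{−1}⟨(δC_j/δA)(U₀, L^{−1}A), δA⟩⟩. (153)
Using (143), (148), (149) we obtain the following bound: |⟨(δ/δA) C_{j+1}(U₀, A), δA⟩| ≤ QC₃L^{−1}|A|Q″_j|δA| +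
C′₁2α₀(L^jη)²Q″C₃L^{−1}|A|Q″_j|δA| + C″₁|L^{−1}Q_j(U₀)A + C_j(U₀, L^{−1}A)| · Q″|L^{−1}Q_j(U₀)δA +
L^{−1}⟨(δC_j/δA)(U₀, L^{−1}A), δA⟩| ≤ C₃(2 − L^{−1})L^{−1}|A|Q″_{j+1}|δA| + C′₁C₃2α₀2d(L^jη)²L^{−1}|A|Q″_{j+1}|δA| +
C″₁L^{−2}(Q_j|A| + 2C′₁α₀(L^jη)²Q″_j|A| + C₂L^{−1}|A|²) · Q″(Q_j|δA| + 2C′₁α₀(L^jη)²Q″_j|δA| + C₃L^{−1}|A|Q″_j|δA|) ≤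
C₃|A|Q″_{j+1}|δA| [1 − L^{−2} + 4dC′₁α₀L^{−3}] + C″₁L^{−2}(1 + 4dC′₁α₀L^{−2} + C₂L^{−1}α₁) · |A| (1 + 4dC′₁α₀L^{−2} +
2dC₃L^{−1}α₁)Q″_{j+1}|δA| ≤ C₃|A|Q″_{j+1}|δA| [1 − L^{−2} + 4dC′₁α₀L^{−3} + (C″₁L^{−2}/C₃) · (1 + 4dC′₁α₀L^{−2} +
C₂L^{−1}α₁ + 2dC₃L^{−1}α₁)²]. (154) This bound implies the inequality (149) for j + 1 if 4dC′₁α₀L^{−1} +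
(C″₁/C₃)(1 + 4dC′₁α₀L^{−2} + C₂L^{−1}α₁ + 2dC₃L^{−1}α₁)² ≤ 1. (155) This inequality is satisfied if C₃ > C″₁ and α₀,
α₁ are sufficiently small, e.g., we may take C₃ = 6C″₁ and α₀, α₁ satisfying 4dC′₁α₀L^{−1} ≤ 1/3, (C₂L^{−1} +
12dC″₁L^{−1})α₁ ≤ 2/3. Thus we have proved"  p. 42: "**Proposition 5.** The functional derivative of Q_k(U₀, ηA) is
a bounded function for α₀, α₁ sufficiently small, and we have the bounds |(δ/δA_b) Q_k(U₀, ηA, c)| ≤ 1 + 2C′₁α₀ +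
C₃|A| < 1 + 2C′₁α₀ + C₃α₁, (156) |(δ/δA_b) C_k(U₀, A, c)| ≤ C₃|A| < C₃α₁. (157)"  Prop. 4, p. 38: "the function
Q_k(U₀, ηA, c) = (1/i) log(U̿₁^k)_c, c ⊂ Ω^{(k)}, is an analytic function of the variables A_b, b ⊂ B^k(c₋)∪B^k(c₊).
Further we have Q_k(U₀, ηA) = Q_k(U₀)A + C_k(U₀, A), (134)".

THE FLAT BACKGROUND.  For `U₀ = 1` every `Ū₀^j = 1`, `α₀ = 0`: the terms with `C′₁α₀` in (139), (143)–(147),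
(153)–(156) vanish, `Q_j(U₀)|_{U₀=1} = Q_j` is the straight-line `L^j`-block average (B5 (1.18); `B7Prop4Flat`:
`linQIter`, `linQIter_eq_linQ_pow`), whose kernel `Q_k(1; c, b)` in (147) is `η^{d+1}·(#{x : [x, x(c)] ∋ b})·η^{−d}
≤ L^k·η = 1` per bond, and every factor of the composite (127)/(150) is the SAME one-step map `Q(1, ·)` of Prop. 3
with remainder `C(1, ·)` (`oneC` below = `log(dbavg(e^{·})) − L·Q₀(·)`).

DICTIONARY print ↦ Lean (conventions of `B7Prop3Flat`/`B7Prop4Flat`: `𝔸` a complete normed `ℂ`-algebra standing for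
`M_N(ℂ)` ⊃ 𝔲(N), the `i` of `U₁ = e^{iηA}` absorbed, every lattice `Ω^{(j)} = L^jηℤ^d` identified with `ℤ^d` by
rescaling, so that a bond `c ⊂ Ω^{(j)}` is a pair `(z, κ) : ℤ^d × Fin d` and is READ on the fine lattice as
`⟨L^jz, L^jz + L^je_κ⟩`).  The fine field: print's `A` on the `η = L^{−k}`-lattice with `|A| = sup_b |A_b| < α₁` ↦
`A : Site d → Fin d → 𝔸` with `∀ b, ‖A_b‖ ≤ a`; `ηA` ↦ the real scalar multiple `((L:ℝ)^k)⁻¹ • A`; in §4 the induction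
runs, as in `B7Prop4Flat`, in the un-normalised `B`-variables `B = ηA`, `sup_b ‖B_b‖ ≤ b` (`b` plays `ηα₁`, `L^jb`
plays `L^jηα₁`).  `Q_j(U₀, ηA)|_{U₀=1}` ↦ `logIter L B j`; `L^jη·Q_j(U₀)A|_{U₀=1}` ↦ `linQIter L B j`;
`C_j(U₀, L^jηA)|_{U₀=1}` of (150) ↦ `CIter L B j := logIter L B j − linQIter L B j` (at `j = k`, `L^kη = 1`, this IS
`C_k(U₀, A)` of (134)/(157)); the one-step remainder `C(V₀, A)(c)|_{V₀=1} = Q(1, A)(c) − L·(Q₀A)_c` ↦ `oneC L F q κ`;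
the bond set `{b ⊂ B(c₋) ∪ B(c₊)}` of (140) for `c = ⟨q, q + Le_κ⟩` ↦ `S1 L q κ = bondsIn q (bondHi L q κ)` (the bonds
with both endpoints in the box `[q, q + (L−1)𝟙 + Le_κ]`), "`b ⊂ B^j(c₋) ∪ B^j(c₊)`" of (141) ↦ `BondIn (loK L j z)
(bondHiK L j z κ) y μ`; the differential (137) `dF(A, δA) = d/dt F(A + tδA)|_{t=0}` ↦ Mathlib's `HasLineDerivAt ℂ F F′ A
δA` / `lineDeriv ℂ F A δA` (`t ∈ ℂ`, as in `B7Ineq148`); the variation singled out by `δ/δA_b`, `b = ⟨y, y + e_μ⟩` ↦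
`δA = bump y μ X` (`= X` on `b`, `0` elsewhere, `X ∈ 𝔸`); (138) "the functional derivative coincides with partial
derivatives … multiplied by `η^{−d}`" ↦ a bound `|δ/δA_b F| ≤ M` is RENDERED as `‖dF(A; X·δ_b)‖ ≤ M·η^d·‖X‖` for all
`X ∈ 𝔸` (DIVERGENCE (b)); `Q″` (140) on a finite bond set ↦ `B7Ineq148.Qpp`; `C″₁` ↦ `C1pp d L = 4 * C1 d * L^(d+2)`;
`C₃` ↦ `C3 d L = 128 * (d+1) * C1 d * L^d`; the level-`j` size of (149) per bond ↦ `K5 d L b j = C3 d L * (L^j)^2 *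
((L^j)^d)⁻¹ * b` (`= C₃|A|·η^d` at `j = k`, `b = η|A|`); "α₀, α₁ sufficiently small" ↦ `α₀ = 0` and `C3 d L * a ≤ 1`.

WHAT THIS FILE PROVES (kernel, no `sorry`, standard axioms), for `L ≥ 2` (§1–§3: `L ≥ 1`), any `d`, any `k`:
* §1 LOCALITY of the concrete maps: `dbavg_congr`/`oneC_congr` — the one-step average (89)|_{V₀=1} at `c = ⟨q, q+Le_κ⟩`
  and its remainder depend on the field only through the bonds of `S1 L q κ` ("`b ⊂ B(c₋) ∪ B(c₊)`");
  `logIter_congr`/`linQIter_congr` — `Q_j(1, ·)(c)`, `Q_j(1)(·)(c)` depend only on the bonds inside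
  `[loK L j z, bondHiK L j z κ]` ("`b ⊂ B^j(c₋) ∪ B^j(c₊)`"); `oneC_eq_ins` — `C(1, F, c) = C(1, ins_S(F|_S), c)` with
  `S = S1 L q κ`, which makes the one-step remainder a function on the finite product `𝔸^S` (where (148) lives).
* §2 `ineq148_flat` — (148) FOR THE CONCRETE `C(1, ·, c)` on `𝔸^S`, ANY finite `S`: `B7Ineq148.Ineq148Printed` with
  radius `½c₃(d, L)` and `C″₁ = 4C₁(d)L^{d+2}` (pv23's Cauchy-estimate theorem `ineq148Printed_of_123` + Prop. 3 at
  `V₀ = 1`: `prop3_flat_C_ins`, `prop3_flat_global`).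
* §3 the single-bond direction: `hasDerivAt_linQIter_line` — (147) at `U₀ = 1` in the form "the linear part is its
  own differential"; `norm_linQIter_bump_le` — `|(L^jη·Q_j(1)(Xδ_b))(c)| ≤ L^j·L^{−jd}·|X|` (print (147): `|Q_k(U₀; c,
  b)| ≤ 1` at `α₀ = 0`, times the `η^d` of (138) and the `L^kη` of the un-normalised `linQIter`);
  `linQIter_bump_eq_zero` (locality); the counting lemmas `card_line_hits_le` (a fine bond meets at most `2L − 1` of the
  `L^d·L` segment bonds of one block average — print's factor `(2 − L^{−1})` in (154)), `card_nearBonds_le` (a fine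
  bond lies in at most `2d` of the boxes `B^j(c′₋) ∪ B^j(c′₊)` — print's `2d` of (142)), `norm_linQ_le_of_two_sites`.
* §4 `CIter_succ` — THE RECURSION (152) at `U₀ = 1` (an algebraic identity of the concrete objects);
  `prop5_flat_induction` — THE (149) INDUCTION at `U₀ = 1`, PER BOND: for `sup_b ‖B_b‖ ≤ b`, `C₃(d, L)·L^k·b ≤ 1`, one
  fine bond `b₀ = ⟨y, y+e_μ⟩`, `X ∈ 𝔸`, every `j ≤ k` and every level-`j` bond `c`: `B′ ↦ C_j(B′)(c)` has a line
  derivative at `B` in the direction `X·δ_{b₀}` ((137), `t ∈ ℂ`), of norm `≤ C₃(L^j)²L^{−jd}·b·‖X‖`, vanishing unless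
  `b₀ ⊂ B^j(c₋) ∪ B^j(c₊)`.  Step `j → j+1` = (153): the chain rule through the finitely many variables `S1` of
  `C(1, ·, c)` (§1, Fréchet-differentiable there by `prop3_flat_C_ins`, its argument `Q_j(1, B)` of size `≤ 2L^jb <
  ½c₃` by (131) `prop4_flat_induction`), (148) `ineq148_flat` for that factor with `Q″` of the inner variation `≤
  L^{−d}·2d·(L^jL^{−jd} + C₃(L^j)²L^{−jd}b)‖X‖`, and `L·Q₀` of the level-`j` derivative bounded by the sharp count
  `2L − 1`; the numerical inequality replacing (155) is `(2L−1)/L² + (16dC₁L^d/C₃)(1 + C₃L^jb) ≤ ¾ + ¼ = 1`.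
* §5 PROPOSITION 5 AT `U₀ = 1`: `prop5_flat_157_B`/`prop5_flat_156_B` (`B`-variables) and, in the printed variables
  with `η = L^{−k}`, `|A| ≤ a`, `C₃(d, L)·a ≤ 1`: `prop5_flat_157` — `A′ ↦ C_k(U₀, A′)(c)|_{U₀=1}` has at `A` the line
  derivative in the direction `X·δ_b` and `‖dC_k(1, A; Xδ_b)(c)‖ ≤ C₃·a·η^d‖X‖` ((157): `|δ/δA_b C_k| ≤ C₃|A|`);
  `prop5_flat_156` — `A′ ↦ Q_k(U₀, ηA′)(c)|_{U₀=1}` is line-differentiable at `A` in the direction `X·δ_b` with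
  `‖lineDeriv‖ ≤ (1 + C₃a)·η^d‖X‖` ((156): `|δ/δA_b Q_k(U₀, ηA, c)| ≤ 1 + 2C′₁α₀ + C₃|A|`, `α₀ = 0`);
  `prop5_flat_157_local` — the derivative vanishes unless `b ⊂ B^k(c₋) ∪ B^k(c₊)`.  All constants are independent of
  `k`; `C″₁`, `C₃` depend on `d` and `L` as print says.

ABSOLUTE-RULE LEDGER.  Hypotheses of every theorem: NONE beyond the displayed smallness conditions (`C₃L^kb ≤ 1`, resp.
`C₃a ≤ 1`) and `L ≥ 2`; all objects are the concrete `dbavg` (89)|_{V₀=1}, `linQ`, `logIter`, `linQIter`, `insCfg` of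
the tree.  (148) is USED only as the kernel-proved theorem `ineq148_flat` (pv23's `ineq148Printed_of_123` + Prop. 3
flat), never as a hypothesis; no `B7.Prop*` placeholder is assumed; nothing of the manuscript is cited as a fact;
`B7.Prop5Printed` (curved background) is neither used nor claimed.

DIVERGENCES from print (located; cell DIVERGENCE.md D-b07g18.1–3).  (a) FLAT BACKGROUND ONLY: `U₀ = 1` (`α₀ = 0`):
Proposition 2, the bound (143) for `Q_j(U₀)` and every `C′₁α₀`-term are absent; the leaf `B7.Prop5Printed` is NOT
discharged.  (b) (D-b07g18.1) THE FUNCTIONAL DERIVATIVE: print defines `δF/δA_b` by trace duality (138) as a Lie-algebra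
valued function and bounds its `|·|`; here, for a general complete normed `ℂ`-algebra `𝔸` (no trace), the statement
`|δ/δA_b F| ≤ M` is rendered as the bound `‖dF(A; X·δ_b)‖ ≤ M·η^d·‖X‖` for every `X ∈ 𝔸` on the differential (137)
in the single-bond direction `X·δ_b` (equivalently: the partial differential in the variable `A_b`, a bounded linear
map `𝔸 → 𝔸`, has operator norm `≤ M·η^d` — "partial derivatives multiplied by `η^{−d}`"); (149) is accordingly proved
PER BOND (for `δA = X·δ_b`, where `Q″_j|δA|(c) = η^d|X|·𝟙[b ⊂ B^j(c₋)∪B^j(c₊)]`), not for general `δA` (the general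
differential is the finite sum over `b` of the per-bond ones by linearity, not spelled out).  (c) (D-b07g18.2)
CONSTANTS AND THRESHOLDS: `C″₁ = 4C₁(d)L^{d+2}` (print: "depends on d and L", no value) comes from pv23's Cauchy
estimate at radius `½c₃`; `C₃ = 128(d+1)C₁(d)L^d` (print: any `C₃ > C″₁` with `α₀, α₁` small, sample `C₃ = 6C″₁`) —
the per-bond bookkeeping trades print's `(C″₁/C₃)(1 + …)²` of (155) for `(C″₁/C₃)·4dL^{−2}·(1 + C₃L^jηα₁)`, and the
smallness is `C₃·α₁ ≤ 1` with `α₁ ↦ a` (print's sample: `(C₂L^{−1} + 12dC″₁L^{−1})α₁ ≤ 2/3`); `C₃α₁ ≤ 1` implies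
`32C₁α₁ ≤ 1`, whence Prop. 4's `8C₁L^kb ≤ 1` and `2L^jb ≤ ¼c₃ < ½c₃` for `j < k` (the radius of (148)); `L ≥ 2` is
used (print: `L` large); the printed strict `<` become `≤`.  (d) (D-b07g18.3) `t ∈ ℂ` in (137) (complex lines, as in
`B7Ineq148` and `B7Prop4Flat` §3; print does not specify the field of `t`), and SETTING as in `B7Prop4Flat` (c): `ℤ^d`,
no torus, a GLOBAL sup bound on `A`, `A_b ∈ 𝔸` arbitrary (print: `A` 𝔲(N)-valued, `|A| < α₁`).  (e) NORMALISATION: §4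
works with `B = ηA` and the un-normalised `linQIter = L^jη·Q_j(1)`, so the level-`j` size `C₃|A|Q″_j|δA|` of (149)
appears as `K5 d L b j·‖X‖ = C₃(L^j)²L^{−jd}b‖X‖` (`(L^j)²b = L^jη|A|·L^j`: one `L^j` is `|A|` on the `L^{−j}`-lattice
of (149), the other the un-normalisation; `L^{−jd} = η_j^d`); §5 converts back to `A`, `η = L^{−k}` exactly.

FINDINGS (cell GAPS.md C-b07g18-1).  At `U₀ = 1` the argument (148)–(155) is correct as printed and closes with
explicit constants, uniformly in `k`: the recursion (152) is an identity of the concrete objects (`CIter_succ`), the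
"(2 − L^{−1})" and "2d" multiplicities of (154)/(142) are exactly the counting lemmas `card_line_hits_le` /
`card_nearBonds_le`, and (148) ("following easily from general properties of the function C(V₀, A)") holds at
`V₀ = 1` with `C″₁ = 4C₁L^{d+2}` by a Cauchy estimate (pv23) on Prop. 3's polydisc.  Print's sample constants in
(155) are arithmetically consistent (`x := 4dC′₁α₀L^{−2} + (C₂ + 2dC₃)L^{−1}α₁ ≤ 1/(3L) + 2/3 ≤ 1`, `(1/6)(1+x)² ≤ 2/3`,
`+ 1/3 ≤ 1`; checked by hand, not kernel — the `α₀`-terms are outside this file).  No gap located.  VALUE = first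
kernel-certified Proposition 5 for the paper's own objects (flat case), the `η`-uniform bound "not clear even for the
linear part" (p. 39) included; NOT summit progress (the curved background `U₀ ≠ 1`, i.e. (139)/(143) with `C′₁α₀`,
and papers B8–B13 remain).

VERSIONS.  v1 (gen 18): §1–§5 as listed.
-/

noncomputable section

open scoped BigOperators
open NormedSpace Finset

namespace Literature.MathematicalPhysics.QuantumFieldTheory.Balaban1983to89.B7Prop5Flat

open B7Prop1Explicit B7Prop2Explicit B7Prop3Flat B7Prop4Flat B7Prop1Local B7Ineq148 MatrixLog

-- `Site` alone would resolve to the torus sites of `Setup.lean`; re-export the `ℤ^d` sites of `B7Prop1Explicit`.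
export B7Prop1Explicit (Site)

variable {d : ℕ}

/-! ## §1 Locality of the concrete `Q(1, ·)`, `L·Q₀`, `Q_j(1, ·)` (p. 24 / p. 31 / p. 34) -/

section Locality

variable {𝔸 : Type*} [NormedRing 𝔸] [NormedAlgebra ℂ 𝔸] [CompleteSpace 𝔸]

/-- The bond `b = ⟨y, y + e_μ⟩` is CONTAINED in the box `[lo, hi]` (p. 24 after (43): "depends only on the bond
variables `U_b` for `b ⊂ B^k(c₋) ∪ B^k(c₊)`"; (140)/(141) p. 39): both endpoints lie in it. [cite: Balaban1985Averaging, p.24 (after (43)), (140)–(141) p.39] -/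
def BondIn (lo hi : Site d) (y : Site d) (μ : Fin d) : Prop := InBox lo hi y ∧ InBox lo hi (y + e μ)

omit [NormedAlgebra ℂ 𝔸] [CompleteSpace 𝔸] in
/-- Locality of the abelian path functional `A([p, p + n e_κ])` along a straight segment inside the box. [folklore] -/
theorem asum_seg_congr {lo hi : Site d} {F F' : Site d → Fin d → 𝔸} (h : AgreeOn lo hi F F') (κ : Fin d) :
    ∀ (n : ℕ) (p : Site d), InBox lo hi p → InBox lo hi (p + (n : ℤ) • e κ) →
      asum F p (seg κ n) = asum F' p (seg κ n)
  | 0, p, _, _ => by simp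
  | n + 1, p, hp, hpn => by
    have hpn0 : InBox lo hi (p + (n : ℤ) • e κ) := by
      refine inBox_of_between hp hpn fun i => Or.inl ?_
      rw [add_zsmul_e_apply, add_zsmul_e_apply]
      split_ifs <;> push_cast <;> omega
    have hpn1 : InBox lo hi (p + (n : ℤ) • e κ + e κ) := by
      have he : p + (n : ℤ) • e κ + e κ = p + ((n + 1 : ℕ) : ℤ) • e κ := by
        push_cast; rw [add_smul, one_smul, add_assoc]
      rw [he]; exact hpn
    rw [asum_seg_succ, asum_seg_succ, asum_seg_congr h κ n p hp hpn0, h _ κ hpn0 hpn1]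

omit [CompleteSpace 𝔸] in
/-- **LOCALITY OF THE MAIN TERM `L·(Q₀A)_c` (122)/(125)**: it depends only on the bond variables `A_b`,
`b ⊂ B(c₋) ∪ B(c₊)` (indeed only on the straight lines `[x, x + Le_κ]`, `x ∈ B(c₋)`). [cite: Balaban1985Averaging, (125) p.36, p.24] -/
theorem linQ_congr (L : ℕ) (q : Site d) (κ : Fin d) {F F' : Site d → Fin d → 𝔸}
    (h : AgreeOn q (bondHi L q κ) F F') : linQ L F q κ = linQ L F' q κ := by
  unfold linQ
  refine Finset.sum_congr rfl fun r _ => ?_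
  have hr : ∀ i, 0 ≤ boxVec L r i ∧ boxVec L r i + 1 ≤ L := fun i =>
    ⟨by simp [boxVec], by have := (r i).isLt; simp only [boxVec]; omega⟩
  rw [asum_seg_congr h κ L (q + boxVec L r) (fun i => ?_) (fun i => ?_)]
  · have := hr i; simp only [bondHi, Pi.add_apply]; split_ifs <;> omega
  · have := hr i
    simp only [bondHi, Pi.add_apply, Pi.smul_apply, e_apply, smul_eq_mul, mul_ite, mul_one, mul_zero]
    split_ifs <;> omega

omit [CompleteSpace 𝔸] in
/-- Locality of the frame exponent `F(y) = Σ_{x∈B(y)} L^{−d} log V(Γ_{y,x})` (110): it depends only on the bonds of the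
block `B(y) = [y, y + (L−1)𝟙]`, hence of any box containing it. [cite: Balaban1985Averaging, (110) p.34, p.31] -/
theorem Favg_congr (L : ℕ) {lo hi : Site d} {V V' : Site d → Fin d → 𝔸ˣ} (h : AgreeOn lo hi V V') (q : Site d)
    (hq : InBox lo hi q) (hqL : ∀ i, q i + ((L : ℤ) - 1) ≤ hi i) : Favg L V q = Favg L V' q := by
  unfold Favg
  refine Finset.sum_congr rfl fun r _ => ?_
  have hr : ∀ i, 0 ≤ boxVec L r i ∧ boxVec L r i + 1 ≤ L := fun i =>
    ⟨by simp [boxVec], by have := (r i).isLt; simp only [boxVec]; omega⟩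
  rw [hol_treeWord_congr h q (boxVec L r) hq fun i => ?_]
  have := hr i; have := hq i; have := hqL i
  simp only [Pi.add_apply]
  constructor <;> omega

/-- Locality of the block frame `v(y) = exp F(y)` (110)/(82). [cite: Balaban1985Averaging, (110) p.34] -/
theorem vframe_congr (L : ℕ) {lo hi : Site d} {V V' : Site d → Fin d → 𝔸ˣ} (h : AgreeOn lo hi V V') (q : Site d)
    (hq : InBox lo hi q) (hqL : ∀ i, q i + ((L : ℤ) - 1) ≤ hi i) : vframe L V q = vframe L V' q := by
  unfold vframe; rw [Favg_congr L h q hq hqL]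

/-- **LOCALITY OF THE DOUBLE-BAR AVERAGE `V̿₁(c)` (89)/(120) at `V₀ = 1`** — p. 31: the operations (89)–(91) "have
the same locality properties" as (42)/(43), i.e. `V̿₁(c)` "depends only on the bond variables `U_b` for
`b ⊂ B(c₋) ∪ B(c₊)`" (p. 24); p. 34: "(V̿₁)_c is an analytic function of the variables A_b, b ⊂ B(c₋)∪B(c₊)".
Kernel-checked for the concrete `dbavg` of `B7Prop3Flat`: two configurations agreeing on the bonds contained in
`[q, q + (L−1)𝟙 + Le_κ] = B(c₋) ∪ B(c₊)` have the same `V̿₁(c)`, `c = ⟨q, q + Le_κ⟩`. [cite: Balaban1985Averaging, p.31 (after (91)), p.24, p.34] -/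
theorem dbavg_congr (L : ℕ) (hL : 1 ≤ L) (q : Site d) (κ : Fin d) {V V' : Site d → Fin d → 𝔸ˣ}
    (h : AgreeOn q (bondHi L q κ) V V') : dbavg L V q κ = dbavg L V' q κ := by
  have hq : InBox q (bondHi L q κ) q := fun i => by
    simp only [bondHi]; split_ifs <;> omega
  have hqL : InBox q (bondHi L q κ) (q + (L : ℤ) • e κ) := fun i => by
    simp only [bondHi, add_zsmul_e_apply]; split_ifs <;> omega
  have h1 : ∀ i, q i + ((L : ℤ) - 1) ≤ bondHi L q κ i := fun i => by
    simp only [bondHi]; split_ifs <;> omega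
  have h2 : ∀ i, (q + (L : ℤ) • e κ) i + ((L : ℤ) - 1) ≤ bondHi L q κ i := fun i => by
    simp only [bondHi, add_zsmul_e_apply]; split_ifs <;> omega
  unfold dbavg
  rw [bavg_congr L hL q κ h, vframe_congr L h q hq h1, vframe_congr L h _ hqL h2]

/-- Agreement of the fields on the bonds of a box gives agreement of the exponentiated configurations `e^{A}` (109). [folklore] -/
theorem agreeOn_expCfg {lo hi : Site d} {F F' : Site d → Fin d → 𝔸} (h : AgreeOn lo hi F F') :
    AgreeOn lo hi (expCfg F) (expCfg F') := fun x κ hx hx' => by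
  unfold expCfg; rw [h x κ hx hx']

/-- **The one-step remainder `C(1, F, c) := Q(1, F, c) − L·(Q₀F)_c`** of Prop. 3 at `V₀ = 1` ((121)–(122) p. 36) as a
function of the (infinite) bond configuration `F` — the function whose Fréchet form on `𝔸^S` is
`B7Prop3Flat.prop3_flat_C_ins`. [cite: Balaban1985Averaging, (121)–(122) p.36] -/
def oneC (L : ℕ) (F : Site d → Fin d → 𝔸) (q : Site d) (κ : Fin d) : 𝔸 :=
  mlog ((dbavg L (expCfg F) q κ : 𝔸ˣ) : 𝔸) - linQ L F q κ

/-- Locality of `Q(1, F, c) = (1/i) log V̿₁(c)[e^{F}]` (121). [cite: Balaban1985Averaging, (121) p.36, p.34] -/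
theorem mlog_dbavg_congr (L : ℕ) (hL : 1 ≤ L) (q : Site d) (κ : Fin d) {F F' : Site d → Fin d → 𝔸}
    (h : AgreeOn q (bondHi L q κ) F F') :
    mlog ((dbavg L (expCfg F) q κ : 𝔸ˣ) : 𝔸) = mlog ((dbavg L (expCfg F') q κ : 𝔸ˣ) : 𝔸) := by
  rw [dbavg_congr L hL q κ (agreeOn_expCfg h)]

/-- Locality of the one-step remainder `C(1, ·, c)`: it depends only on `F_b`, `b ⊂ B(c₋) ∪ B(c₊)`. [cite: Balaban1985Averaging, p.34, (122) p.36] -/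
theorem oneC_congr (L : ℕ) (hL : 1 ≤ L) (q : Site d) (κ : Fin d) {F F' : Site d → Fin d → 𝔸}
    (h : AgreeOn q (bondHi L q κ) F F') : oneC L F q κ = oneC L F' q κ := by
  unfold oneC; rw [mlog_dbavg_congr L hL q κ h, linQ_congr L q κ h]

/-- The box arithmetic of the `k → k+1` step (as in `B7Prop1Local.avgIter_congr`): if the unit-lattice bond
`⟨x, x + e_μ⟩` is contained in `B(Lq) ∪ B(Lq + Le_κ)` (one-step blocks of the `L`-bond at `Lq`), then the box
`B^j(x) ∪ B^j(x + e_μ)` of the original lattice is contained in `B^{j+1}(c₋) ∪ B^{j+1}(c₊)`, `c = ⟨q, q + e_κ⟩` of the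
`(j+1)`-st lattice. [cite: Balaban1985Averaging, p.24, (2)–(3) p.17] -/
theorem inBox_nest (L : ℕ) (j : ℕ) (q : Site d) (κ : Fin d) {x : Site d} {μ : Fin d}
    (hx : BondIn ((L : ℤ) • q) (bondHi L ((L : ℤ) • q) κ) x μ) {p : Site d}
    (hp : InBox (loK L j x) (bondHiK L j x μ) p) : InBox (loK L (j + 1) q) (bondHiK L (j + 1) q κ) p := by
  have hP : (0 : ℤ) ≤ (L : ℤ) ^ j := by positivity
  obtain ⟨hx1, hx2⟩ := hx
  intro i
  have h1 := (hx1 i).1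
  have h2 := (hx1 i).2
  have h3 := (hx2 i).2
  have hp1 := (hp i).1
  have hp2 := (hp i).2
  simp only [Pi.smul_apply, smul_eq_mul] at h1
  simp only [bondHi, Pi.smul_apply, smul_eq_mul, add_e_apply] at h2 h3
  simp only [loK] at hp1
  simp only [bondHiK] at hp2
  have h1' := mul_le_mul_of_nonneg_left h1 hP
  have h2' := mul_le_mul_of_nonneg_left h2 hP
  have h3' := mul_le_mul_of_nonneg_left h3 hP
  simp only [loK, bondHiK, pow_succ]
  constructor
  · nlinarith
  · split_ifs at h2' h3' hp2 ⊢ <;> nlinarith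

/-- **LOCALITY OF THE COMPOSITE `Q_j(1, ·)(c)`** — p. 24 (43)/(91): "`Ū^k_c`, `c ⊂ Ω^{(k)}`, depends only on the bond
variables `U_b` for `b ⊂ B^k(c₋) ∪ B^k(c₊)`", for the double-bar averages by p. 31 ("the same locality properties"),
kernel-checked for the concrete `logIter` of `B7Prop4Flat` (the reading disclosed as D-b07g17.3 / pv08-g5 INFO I-1,
now a theorem): two bond fields agreeing on the bonds contained in `[L^jz, L^jz + (L^j − 1)𝟙 + L^je_κ]` give the same
`Q_j(1, ·)` at the `L^j`-bond `⟨L^jz, L^jz + L^je_κ⟩`. [cite: Balaban1985Averaging, p.24 (after (43)), p.31 (after (91)), (127) p.37] -/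
theorem logIter_congr (L : ℕ) (hL : 1 ≤ L) :
    ∀ (j : ℕ) {B B' : Site d → Fin d → 𝔸} (z : Site d) (κ : Fin d),
      AgreeOn (loK L j z) (bondHiK L j z κ) B B' → logIter L B j z κ = logIter L B' j z κ
  | 0, B, B', z, κ, h => by
    refine h z κ (fun i => ?_) (fun i => ?_)
    · simp only [loK, bondHiK, pow_zero, one_mul]; split_ifs <;> omega
    · simp only [loK, bondHiK, pow_zero, one_mul, add_e_apply]; split_ifs <;> omega
  | j + 1, B, B', z, κ, h => by
    rw [logIter_succ, logIter_succ]
    refine mlog_dbavg_congr L hL _ κ fun x μ hx hxe => logIter_congr L hL j x μ fun p ν hp hpν => ?_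
    exact h p ν (inBox_nest L j z κ ⟨hx, hxe⟩ hp) (inBox_nest L j z κ ⟨hx, hxe⟩ hpν)

omit [CompleteSpace 𝔸] in
/-- Locality of the composed linear part `Q_j(1)` (127)/(130): same dependence set. [cite: Balaban1985Averaging, (127) p.37, p.39] -/
theorem linQIter_congr (L : ℕ) :
    ∀ (j : ℕ) {B B' : Site d → Fin d → 𝔸} (z : Site d) (κ : Fin d),
      AgreeOn (loK L j z) (bondHiK L j z κ) B B' → linQIter L B j z κ = linQIter L B' j z κ
  | 0, B, B', z, κ, h => by
    refine h z κ (fun i => ?_) (fun i => ?_)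
    · simp only [loK, bondHiK, pow_zero, one_mul]; split_ifs <;> omega
    · simp only [loK, bondHiK, pow_zero, one_mul, add_e_apply]; split_ifs <;> omega
  | j + 1, B, B', z, κ, h => by
    rw [linQIter_succ, linQIter_succ]
    refine linQ_congr L _ κ fun x μ hx hxe => linQIter_congr L j x μ fun p ν hp hpν => ?_
    exact h p ν (inBox_nest L j z κ ⟨hx, hxe⟩ hp) (inBox_nest L j z κ ⟨hx, hxe⟩ hpν)

/-! ### Restriction to the finite parameter space `𝔸^S`, `S` = the bonds of `B(c₋) ∪ B(c₊)` -/

/-- The coordinate box `[lo, hi]` of `ℤ^d` as a `Finset`. [folklore] -/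
def boxFinset (lo hi : Site d) : Finset (Site d) := Fintype.piFinset fun i => Finset.Icc (lo i) (hi i)

omit [NormedRing 𝔸] [NormedAlgebra ℂ 𝔸] [CompleteSpace 𝔸] in
/-- Membership in the box `Finset` is `InBox`. [folklore] -/
theorem mem_boxFinset {lo hi x : Site d} : x ∈ boxFinset lo hi ↔ InBox lo hi x := by
  simp [boxFinset, InBox, Fintype.mem_piFinset]

/-- The finite set of bonds `b ⊂ [lo, hi]` (both endpoints in the box) — for `[lo, hi] = B(c₋) ∪ B(c₊)` these are the
variables of `V̿₁(c)` (p. 34) and the index set of `Q″` (140). [cite: Balaban1985Averaging, (140) p.39, p.34] -/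
def bondsIn (lo hi : Site d) : Finset (Site d × Fin d) :=
  ((boxFinset lo hi) ×ˢ (Finset.univ : Finset (Fin d))).filter fun s => s.1 + e s.2 ∈ boxFinset lo hi

omit [NormedRing 𝔸] [NormedAlgebra ℂ 𝔸] [CompleteSpace 𝔸] in
/-- Membership in `bondsIn` is `BondIn` (both endpoints in the box). [folklore] -/
theorem mem_bondsIn {lo hi : Site d} {s : Site d × Fin d} : s ∈ bondsIn lo hi ↔ BondIn lo hi s.1 s.2 := by
  simp [bondsIn, BondIn, mem_boxFinset]

/-- Restriction of a bond field to the coordinates `𝔸^S`. [folklore] -/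
def restr (S : Finset (Site d × Fin d)) (F : Site d → Fin d → 𝔸) : S → 𝔸 := fun s => F s.1.1 s.1.2

omit [NormedAlgebra ℂ 𝔸] [CompleteSpace 𝔸] in
/-- Inserting the restriction reproduces the field on the bonds of `S`. [folklore] -/
theorem insCfg_restr_of_mem (S : Finset (Site d × Fin d)) (F : Site d → Fin d → 𝔸) {x : Site d} {κ : Fin d}
    (h : (x, κ) ∈ S) : insCfg S (restr S F) x κ = F x κ := by
  simp [insCfg, restr, h]

omit [NormedAlgebra ℂ 𝔸] [CompleteSpace 𝔸] in
/-- The inserted restriction agrees with the field on the bonds of the box. [folklore] -/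
theorem agreeOn_insCfg_restr (lo hi : Site d) (F : Site d → Fin d → 𝔸) :
    AgreeOn lo hi F (insCfg (bondsIn lo hi) (restr (bondsIn lo hi) F)) := fun x κ hx hx' => by
  rw [insCfg_restr_of_mem]
  exact mem_bondsIn.mpr ⟨hx, hx'⟩

/-- The bonds `b ⊂ B(c₋) ∪ B(c₊)` of the `L`-bond `c = ⟨q, q + Le_κ⟩` — the variables of `C(1, ·, c)`. [cite: Balaban1985Averaging, p.34, (140) p.39] -/
def S1 (L : ℕ) (q : Site d) (κ : Fin d) : Finset (Site d × Fin d) := bondsIn q (bondHi L q κ)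

/-- `C(1, F, c)` IS a function of the finitely many variables `F_b`, `b ⊂ B(c₋) ∪ B(c₊)`: it equals the `𝔸^{S}`-function of
`B7Prop3Flat.prop3_flat_C_ins` (`S = S1`) evaluated at the restriction of `F`. [cite: Balaban1985Averaging, p.34, (122) p.36] -/
theorem oneC_eq_ins (L : ℕ) (hL : 1 ≤ L) (F : Site d → Fin d → 𝔸) (q : Site d) (κ : Fin d) :
    oneC L F q κ = oneC L (insCfg (S1 L q κ) (restr (S1 L q κ) F)) q κ :=
  oneC_congr L hL q κ (agreeOn_insCfg_restr q (bondHi L q κ) F)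

end Locality

/-! ## §2 The printed one-step bound (148) for the CONCRETE remainder `C(1, ·, c)` -/

section OneStep

variable {𝔸 : Type*} [NormedRing 𝔸] [NormedAlgebra ℂ 𝔸] [CompleteSpace 𝔸]

/-- The witness for the printed `C″₁` of (148) ("The constant C″₁ depends on d and L"): `C″₁(d, L) = 4C₁(d)L^{d+2}`
(`B7Ineq148.ineq148Printed_of_123`). [cite: Balaban1985Averaging, (148) p.40] -/
def C1pp (d L : ℕ) : ℝ := 4 * C1 d * (L : ℝ) ^ (d + 2)

/-- **(148) FOR THE CONCRETE ONE-STEP REMAINDER AT `V₀ = 1`** — p. 40: "For one-step renormalization transformation we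
have the bound |⟨δC(V₀, A)/δA, δA⟩| ≤ C″₁|A|Q″|δA| (148) following easily from general properties of the function
C(V₀, A). The constant C″₁ depends on d and L."  PROVED for `C = C(1, ·, c)` as a function on `𝔸^S` (any finite bond set
`S`, other bonds at the unit): `B7Ineq148.Ineq148Printed` holds with `ρ = ½c₃(d, L)` and `C″₁ = 4C₁(d)L^{d+2}` — pv23's
`ineq148Printed_of_123` (Cauchy estimate on complex lines) fed with Prop. 3 at `V₀ = 1`: analyticity on the polydisc
`|A_b| < c₃` (`prop3_flat_C_ins`) and (123) `|C| ≤ C₁L²|A|²` (`prop3_flat_global`). [cite: Balaban1985Averaging, (148) p.40, Prop. 3 (122)–(123) p.36] -/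
theorem ineq148_flat (S : Finset (Site d × Fin d)) (L : ℕ) (hL : 1 ≤ L) (q : Site d) (κ : Fin d) :
    Ineq148Printed (fun a : S → 𝔸 => oneC L (insCfg S a) q κ) (L : ℝ) d (c3 d L / 2) (C1pp d L) := by
  have hL0 : (0 : ℝ) < L := by exact_mod_cast hL
  refine ineq148Printed_of_123 hL0 (C1_pos d).le ?_ ?_
  · refine ((prop3_flat_C_ins S L hL q κ).1.differentiableOn).mono fun a ha s => ?_
    rw [Metric.mem_ball, dist_zero_right] at ha
    exact (norm_le_pi_norm a s).trans_lt ha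
  · intro a ha
    rw [Metric.mem_ball, dist_zero_right] at ha
    exact (prop3_flat_global (insCfg S a) (norm_nonneg a) (norm_insCfg_le S a) L hL ha.le q κ).1

end OneStep

/-! ## §3 The single-bond direction `X·δ_b` (138), block arithmetic, and the per-bond size of the linear part -/

section SingleBond

variable {𝔸 : Type*} [NormedRing 𝔸] [NormedAlgebra ℂ 𝔸] [CompleteSpace 𝔸]

/-- The single-bond variation `δA = X·δ_{b₀}`, `b₀ = ⟨y, y + e_μ⟩`, `X ∈ 𝔸`: the direction singled out by the partial
derivative `δ/δA_{b₀}` of (138) (p. 39: "the functional derivative coincides with partial derivatives (gradient) of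
F(A) multiplied by η^{−d}"). [cite: Balaban1985Averaging, (137)–(138) p.39] -/
def bump (y : Site d) (μ : Fin d) (X : 𝔸) : Site d → Fin d → 𝔸 := fun x κ => if x = y ∧ κ = μ then X else 0

omit [NormedAlgebra ℂ 𝔸] [CompleteSpace 𝔸] in
/-- The single-bond variation vanishes off its bond. [folklore] -/
theorem bump_eq_zero_of {y x : Site d} {μ κ : Fin d} (X : 𝔸) (h : ¬(x = y ∧ κ = μ)) : bump y μ X x κ = 0 := by
  simp [bump, h]

omit [NormedAlgebra ℂ 𝔸] [CompleteSpace 𝔸] in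
/-- The single-bond variation is bounded by `‖X‖` bondwise. [folklore] -/
theorem norm_bump_le (y : Site d) (μ : Fin d) (X : 𝔸) (x : Site d) (κ : Fin d) : ‖bump y μ X x κ‖ ≤ ‖X‖ := by
  unfold bump; split_ifs <;> simp

omit [CompleteSpace 𝔸] in
/-- Real rescaling of the single-bond variation: `c·(Xδ_b) = (cX)δ_b` (the `η` of `ηδA`). [folklore] -/
theorem smul_bump (c : ℝ) (y : Site d) (μ : Fin d) (X : 𝔸) : c • bump y μ X = bump y μ (c • X) := by
  funext x κ; by_cases h : x = y ∧ κ = μ <;> simp [bump, h]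

omit [CompleteSpace 𝔸] in
/-- `L·Q₀` (125) is additive — bookkeeping (from `B7Prop4Flat.linQ_sub`). [folklore] -/
theorem linQ_add (L : ℕ) (F G : Site d → Fin d → 𝔸) (q : Site d) (κ : Fin d) :
    linQ L (F + G) q κ = linQ L F q κ + linQ L G q κ := by
  have h := linQ_sub L (F + G) G q κ
  rw [add_sub_cancel_right] at h
  rw [h, sub_add_cancel]

omit [CompleteSpace 𝔸] in
/-- The composed linear part `Q_j(1)` (127) is additive — bookkeeping. [folklore] -/
theorem linQIter_add (L : ℕ) (F G : Site d → Fin d → 𝔸) :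
    ∀ (j : ℕ) (z : Site d) (κ : Fin d), linQIter L (F + G) j z κ = linQIter L F j z κ + linQIter L G j z κ
  | 0, _, _ => rfl
  | j + 1, z, κ => by
    have hfun : linQIter L (F + G) j = linQIter L F j + linQIter L G j :=
      funext fun z' => funext fun κ' => linQIter_add L F G j z' κ'
    rw [linQIter_succ, hfun, linQ_add, linQIter_succ, linQIter_succ]

omit [CompleteSpace 𝔸] in
/-- Along the complex line `B + tδB` the linear part is affine: `Q_j(1)(B + tδB) = Q_j(1)B + t·Q_j(1)δB`, so its
`t`-derivative is `Q_j(1)δB` (the term `L^{−1}Q_j(U₀)δA` of (153)). [cite: Balaban1985Averaging, (153) p.41] -/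
theorem hasDerivAt_linQIter_line (L : ℕ) (B D : Site d → Fin d → 𝔸) (j : ℕ) (x : Site d) (κ : Fin d) :
    HasDerivAt (fun t : ℂ => linQIter L (B + t • D) j x κ) (linQIter L D j x κ) 0 := by
  have h : ∀ t : ℂ, linQIter L (B + t • D) j x κ = linQIter L B j x κ + t • linQIter L D j x κ := fun t => by
    rw [linQIter_add, linQIter_csmul]
  simp_rw [h]
  exact (((hasDerivAt_id (0 : ℂ)).smul_const (linQIter L D j x κ)).const_add _).congr_deriv (one_smul _ _)

omit [CompleteSpace 𝔸] in
/-- `L·Q₀` of a `t`-differentiable family is `t`-differentiable with derivative `L·Q₀` of the derivative (a finite sum of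
bond variables) — the term `Q(Ū₀^j) δC_j/δA` of (153). [cite: Balaban1985Averaging, (153) p.41, (125) p.36] -/
theorem hasDerivAt_linQ_family (L : ℕ) {Φ : ℂ → Site d → Fin d → 𝔸} {Φ' : Site d → Fin d → 𝔸} (q : Site d)
    (κ : Fin d) (h : ∀ x, HasDerivAt (fun t => Φ t x κ) (Φ' x κ) 0) :
    HasDerivAt (fun t => linQ L (Φ t) q κ) (linQ L Φ' q κ) 0 := by
  simp only [linQ_eq_sum]
  exact HasDerivAt.fun_sum fun r _ => (HasDerivAt.fun_sum fun i _ => h _).fun_const_smul (((L : ℝ) ^ d)⁻¹)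

/-! ### Block arithmetic: which blocks can contain a given bond -/

/-- The `L^j`-block containing the site `y`: `w_i = ⌊y_i / L^j⌋`. [cite: Balaban1985Averaging, (2)–(3) p.17] -/
def blockPt (L j : ℕ) (y : Site d) : Site d := fun i => y i / (L : ℤ) ^ j

omit [NormedRing 𝔸] [NormedAlgebra ℂ 𝔸] [CompleteSpace 𝔸] in
/-- A site `y` of `B^j(c₋) ∪ B^j(c₊)`, `c = ⟨x, x + e_κ⟩` (read on the unit lattice: the box
`[L^jx, L^jx + (L^j−1)𝟙 + L^je_κ]`), lies in the block of `x` or of `x + e_κ`: `x ∈ {w, w − e_κ}`, `w` = the block of `y`.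
Hence at most `2d` bonds `c` of the `L^{j}`-lattice have a given unit-lattice bond inside `B^j(c₋) ∪ B^j(c₊)`. [folklore] -/
theorem eq_blockPt_or (L : ℕ) (hL : 1 ≤ L) (j : ℕ) {x y : Site d} {κ : Fin d}
    (h : InBox (loK L j x) (bondHiK L j x κ) y) : x = blockPt L j y ∨ x = blockPt L j y - e κ := by
  have hL0 : (0 : ℤ) < L := by exact_mod_cast hL
  have hP : (0 : ℤ) < (L : ℤ) ^ j := pow_pos hL0 j
  have hlo : ∀ i, x i ≤ y i / (L : ℤ) ^ j := fun i =>
    (Int.le_ediv_iff_mul_le hP).2 (by have := (h i).1; simp only [loK] at this; linarith [mul_comm (x i) ((L:ℤ)^j)])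
  have hhi : ∀ i, y i / (L : ℤ) ^ j < x i + 1 + (if i = κ then 1 else 0) := fun i =>
    (Int.ediv_lt_iff_lt_mul hP).2 (by
      have := (h i).2; simp only [bondHiK] at this; split_ifs at this ⊢ <;> nlinarith)
  by_cases hκ : y κ / (L : ℤ) ^ j = x κ
  · left; funext i
    by_cases hi : i = κ
    · subst hi; simpa [blockPt] using hκ.symm
    · have h1 := hlo i; have h2 := hhi i; rw [if_neg hi] at h2; simp only [blockPt]; omega
  · right; funext i
    by_cases hi : i = κ
    · subst hi; have h1 := hlo i; have h2 := hhi i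
      simp only [if_true] at h2
      simp only [blockPt, Pi.sub_apply, e_apply, if_true]; omega
    · have h1 := hlo i; have h2 := hhi i; rw [if_neg hi] at h2
      simp only [blockPt, Pi.sub_apply, e_apply, if_neg hi]; omega

/-- The (at most `2d`) bonds `⟨x, x + e_κ⟩` of a lattice with `x ∈ {w, w − e_κ}`. [folklore] -/
def nearBonds (w : Site d) : Finset (Site d × Fin d) :=
  Finset.univ.biUnion fun κ : Fin d => ({(w, κ), (w - e κ, κ)} : Finset (Site d × Fin d))

omit [NormedRing 𝔸] [NormedAlgebra ℂ 𝔸] [CompleteSpace 𝔸] in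
/-- At most `2d` bonds `⟨x, x + e_κ⟩` have `x ∈ {w, w − e_κ}` (print's `2d` of (142)). [cite: Balaban1985Averaging, (142) p.39] -/
theorem card_nearBonds_le (w : Site d) : (nearBonds w).card ≤ 2 * d := by
  unfold nearBonds
  refine (Finset.card_biUnion_le).trans ?_
  calc ∑ κ : Fin d, ({(w, κ), (w - e κ, κ)} : Finset (Site d × Fin d)).card ≤ ∑ _κ : Fin d, 2 :=
        Finset.sum_le_sum fun κ _ => Finset.card_le_two
    _ = 2 * d := by simp [mul_comm]

omit [NormedRing 𝔸] [NormedAlgebra ℂ 𝔸] [CompleteSpace 𝔸] in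
/-- A level-`j` bond `c = ⟨x, x + e_κ⟩` whose box `B^j(c₋) ∪ B^j(c₊)` contains the fine bond `⟨y, y + e_μ⟩` is one of
the `≤ 2d` bonds near the block `w` of `y`. [folklore] -/
theorem mem_nearBonds_of_bondIn (L : ℕ) (hL : 1 ≤ L) (j : ℕ) {x y : Site d} {κ μ : Fin d}
    (h : BondIn (loK L j x) (bondHiK L j x κ) y μ) : (x, κ) ∈ nearBonds (blockPt L j y) := by
  unfold nearBonds
  rw [Finset.mem_biUnion]
  refine ⟨κ, Finset.mem_univ _, ?_⟩
  rcases eq_blockPt_or L hL j h.1 with hx | hx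
  · rw [hx]; simp
  · rw [hx]; simp

omit [NormedRing 𝔸] [NormedAlgebra ℂ 𝔸] [CompleteSpace 𝔸] in
/-- A sum of terms bounded by `M` and vanishing outside `T` is at most `|T|·M` — bookkeeping. [folklore] -/
theorem sum_le_card_mul_of_zero {ι : Type*} (s T : Finset ι) (g : ι → ℝ) {M : ℝ} (hM : 0 ≤ M)
    (hg : ∀ i ∈ s, g i ≤ M) (h0 : ∀ i ∈ s, i ∉ T → g i = 0) :
    ∑ i ∈ s, g i ≤ T.card * M := by
  classical
  have h1 : ∑ i ∈ s ∩ T, g i = ∑ i ∈ s, g i :=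
    Finset.sum_subset Finset.inter_subset_left fun i hi hni => h0 i hi fun hT =>
      hni (Finset.mem_inter.2 ⟨hi, hT⟩)
  rw [← h1]
  calc ∑ i ∈ s ∩ T, g i ≤ ∑ _i ∈ s ∩ T, M := Finset.sum_le_sum fun i hi => hg i (Finset.mem_inter.1 hi).1
    _ = (s ∩ T).card * M := by rw [Finset.sum_const, nsmul_eq_mul]
    _ ≤ T.card * M := by
        gcongr
        exact Finset.inter_subset_right

omit [NormedRing 𝔸] [NormedAlgebra ℂ 𝔸] [CompleteSpace 𝔸] in
/-- THE SHARP LINE COUNT behind print's `C₃(2 − L^{−1})L^{−1}` in (154) (and "QQ″_j|A| ≤ 2Q″_{j+1}|A|", p. 40): among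
the `L^d·L` pairs (block point `r`, position `i` on the segment `[Lz + r, Lz + r + Le_κ]`) at most `2L − 1` hit a given
pair of sites `{w, w − e_κ}` (parity of `r_κ − i`). [cite: Balaban1985Averaging, p.40 (after (144)), (154) p.41] -/
theorem card_line_hits_le (L : ℕ) (hL : 1 ≤ L) (z w : Site d) (κ : Fin d) :
    (Finset.univ.filter fun ri : (Fin d → Fin L) × Fin L =>
        (L : ℤ) • z + boxVec L ri.1 + ((ri.2 : ℕ) : ℤ) • e κ = w ∨
          (L : ℤ) • z + boxVec L ri.1 + ((ri.2 : ℕ) : ℤ) • e κ = w - e κ).card ≤ 2 * L - 1 := by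
  classical
  set T := Finset.univ.filter fun ri : (Fin d → Fin L) × Fin L =>
        (L : ℤ) • z + boxVec L ri.1 + ((ri.2 : ℕ) : ℤ) • e κ = w ∨
          (L : ℤ) • z + boxVec L ri.1 + ((ri.2 : ℕ) : ℤ) • e κ = w - e κ
  have hcoord : ∀ ri ∈ T, ∀ i, (L : ℤ) * z i + ((ri.1 i : ℕ) : ℤ) + (if i = κ then ((ri.2 : ℕ) : ℤ) else 0) = w i ∨
      (L : ℤ) * z i + ((ri.1 i : ℕ) : ℤ) + (if i = κ then ((ri.2 : ℕ) : ℤ) else 0) = w i - (if i = κ then 1 else 0) := by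
    intro ri hri i
    have h := (Finset.mem_filter.1 hri).2
    rcases h with h | h
    · left; have := congrFun h i
      simpa [Pi.add_apply, Pi.smul_apply, boxVec, e_apply, smul_eq_mul] using this
    · right; have := congrFun h i
      simpa [Pi.add_apply, Pi.smul_apply, Pi.sub_apply, boxVec, e_apply, smul_eq_mul] using this
  have hinj : Set.InjOn (fun ri : (Fin d → Fin L) × Fin L => (ri.1 κ : ℕ) + (L - 1) - (ri.2 : ℕ)) T := by
    intro ri hri ri' hri' hf
    simp only at hf
    have hκ := hcoord ri hri κ
    have hκ' := hcoord ri' hri' κ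
    simp only [if_true] at hκ hκ'
    have h1 := (ri.1 κ).isLt; have h2 := ri.2.isLt; have h3 := (ri'.1 κ).isLt; have h4 := ri'.2.isLt
    have hrk : (ri.1 κ : ℕ) = ri'.1 κ ∧ (ri.2 : ℕ) = ri'.2 := by omega
    refine Prod.ext (funext fun i => Fin.ext ?_) (Fin.ext hrk.2)
    by_cases hi : i = κ
    · subst hi; exact hrk.1
    · have hc := hcoord ri hri i
      have hc' := hcoord ri' hri' i
      simp only [if_neg hi] at hc hc'
      omega
  have hmaps : Set.MapsTo (fun ri : (Fin d → Fin L) × Fin L => (ri.1 κ : ℕ) + (L - 1) - (ri.2 : ℕ)) T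
      (Finset.range (2 * L - 1) : Finset ℕ) := by
    intro ri _
    have h1 := (ri.1 κ).isLt; have h2 := ri.2.isLt
    simp only [Finset.coe_range, Set.mem_Iio]
    omega
  calc T.card ≤ (Finset.range (2 * L - 1)).card := Finset.card_le_card_of_injOn _ hmaps hinj
    _ = 2 * L - 1 := Finset.card_range _

omit [CompleteSpace 𝔸] in
/-- PER-BOND SIZE OF `Q(Ū₀^j)` AT `α₀ = 0`, SHARP FORM: if a field `G` (one direction `κ`) is bounded by `M` and
vanishes off the two sites `{w, w − e_κ}`, then `|L·(Q₀G)_c| ≤ L^{−d}(2L − 1)·M` at every `L`-bond `c` — the origin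
of print's `(2 − L^{−1})L^{−1}` in (154) (`(2L−1)·L^{−d}` against the level ratio `L^{d−2}` of the sizes `K5` gives
`(2L−1)/L² ≤ ¾` for `L ≥ 2`). [cite: Balaban1985Averaging, p.40 (after (144)), (154) p.41] -/
theorem norm_linQ_le_of_two_sites (L : ℕ) (hL : 1 ≤ L) (G : Site d → Fin d → 𝔸) (κ : Fin d) {M : ℝ}
    (hM : 0 ≤ M) (hG : ∀ x, ‖G x κ‖ ≤ M) (w : Site d) (hGw : ∀ x, x ≠ w → x ≠ w - e κ → G x κ = 0)
    (z : Site d) : ‖linQ L G ((L : ℤ) • z) κ‖ ≤ ((L : ℝ) ^ d)⁻¹ * ((2 * L - 1 : ℕ) * M) := by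
  classical
  rw [linQ_eq_sum]
  have hLd : (0 : ℝ) ≤ ((L : ℝ) ^ d)⁻¹ := by positivity
  calc ‖∑ r : Fin d → Fin L, ((L : ℝ) ^ d)⁻¹ •
          ∑ i : Fin L, G ((L : ℤ) • z + boxVec L r + ((i : ℕ) : ℤ) • e κ) κ‖
      ≤ ∑ r : Fin d → Fin L, ((L : ℝ) ^ d)⁻¹ *
          ∑ i : Fin L, ‖G ((L : ℤ) • z + boxVec L r + ((i : ℕ) : ℤ) • e κ) κ‖ := by
        refine (norm_sum_le _ _).trans (Finset.sum_le_sum fun r _ => ?_)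
        rw [norm_smul, norm_inv, norm_pow, Real.norm_natCast]
        exact mul_le_mul_of_nonneg_left (norm_sum_le _ _) hLd
    _ = ((L : ℝ) ^ d)⁻¹ * ∑ ri : (Fin d → Fin L) × Fin L,
          ‖G ((L : ℤ) • z + boxVec L ri.1 + ((ri.2 : ℕ) : ℤ) • e κ) κ‖ := by
        rw [← Finset.mul_sum, Fintype.sum_prod_type]
    _ ≤ ((L : ℝ) ^ d)⁻¹ * ((2 * L - 1 : ℕ) * M) := by
        refine mul_le_mul_of_nonneg_left ?_ hLd
        refine (sum_le_card_mul_of_zero Finset.univ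
          (Finset.univ.filter fun ri : (Fin d → Fin L) × Fin L =>
            (L : ℤ) • z + boxVec L ri.1 + ((ri.2 : ℕ) : ℤ) • e κ = w ∨
              (L : ℤ) • z + boxVec L ri.1 + ((ri.2 : ℕ) : ℤ) • e κ = w - e κ)
          (fun ri => ‖G ((L : ℤ) • z + boxVec L ri.1 + ((ri.2 : ℕ) : ℤ) • e κ) κ‖) hM (fun ri _ => hG _)
          fun ri _ hri => ?_).trans ?_
        · rw [norm_eq_zero]
          simp only [Finset.mem_filter, Finset.mem_univ, true_and, not_or] at hri
          exact hGw _ hri.1 hri.2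
        · exact mul_le_mul_of_nonneg_right (by exact_mod_cast card_line_hits_le L hL z w κ) hM

omit [NormedRing 𝔸] [NormedAlgebra ℂ 𝔸] [CompleteSpace 𝔸] in
/-- Every segment bond `⟨Lz + r + ie_κ, · + e_κ⟩`, `r ∈ [0, L)^d`, `i < L`, of the average (125) lies in
`B(c₋) ∪ B(c₊)`, `c = ⟨Lz, Lz + Le_κ⟩`. [cite: Balaban1985Averaging, (125) p.36, p.24] -/
theorem bondIn_line (L : ℕ) (z : Site d) (κ : Fin d) (r : Fin d → Fin L) (i : Fin L) :
    BondIn ((L : ℤ) • z) (bondHi L ((L : ℤ) • z) κ) ((L : ℤ) • z + boxVec L r + ((i : ℕ) : ℤ) • e κ) κ := by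
  have hr : ∀ ν, (0 : ℤ) ≤ boxVec L r ν ∧ boxVec L r ν + 1 ≤ L := fun ν =>
    ⟨by simp [boxVec], by have := (r ν).isLt; simp only [boxVec]; omega⟩
  have hi : ((i : ℕ) : ℤ) + 1 ≤ L := by have := i.isLt; omega
  have hi0 : (0 : ℤ) ≤ ((i : ℕ) : ℤ) := by positivity
  constructor <;> intro ν <;> have := hr ν
  · simp only [bondHi, Pi.add_apply, Pi.smul_apply, smul_eq_mul, e_apply, mul_ite, mul_one, mul_zero]
    split_ifs <;> constructor <;> linarith
  · simp only [bondHi, Pi.add_apply, Pi.smul_apply, smul_eq_mul, e_apply, mul_ite, mul_one, mul_zero]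
    split_ifs <;> constructor <;> linarith

/-! ### The linear part in the single-bond direction: `|Q_j(1)(X·δ_b)| ≤ L^{j}·L^{−jd}|X|` per bond, local -/

omit [NormedRing 𝔸] [NormedAlgebra ℂ 𝔸] [CompleteSpace 𝔸] in
/-- If the unit-lattice site `y = L^jz + r + ie_κ` (`r ∈ [0, L^j)^d`, `i < L^j`) then the bond `⟨y, y + e_κ⟩` lies in
`B^j(c₋) ∪ B^j(c₊)`, `c = ⟨z, z + e_κ⟩` of the `L^j`-lattice. [cite: Balaban1985Averaging, p.24, (2)–(3) p.17] -/
theorem bondIn_pow_line (L : ℕ) (j : ℕ) (z : Site d) (κ : Fin d) (r : Fin d → Fin (L ^ j)) (i : Fin (L ^ j)) :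
    BondIn (loK L j z) (bondHiK L j z κ) (((L ^ j : ℕ) : ℤ) • z + boxVec (L ^ j) r + ((i : ℕ) : ℤ) • e κ) κ := by
  have hP : ((L ^ j : ℕ) : ℤ) = (L : ℤ) ^ j := by push_cast; rfl
  have hr : ∀ ν, (0 : ℤ) ≤ boxVec (L ^ j) r ν ∧ boxVec (L ^ j) r ν + 1 ≤ (L : ℤ) ^ j := fun ν =>
    ⟨by simp [boxVec], by have := (r ν).isLt; simp only [boxVec, ← hP]; omega⟩
  have hi : ((i : ℕ) : ℤ) + 1 ≤ (L : ℤ) ^ j := by have := i.isLt; rw [← hP]; omega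
  have hi0 : (0 : ℤ) ≤ ((i : ℕ) : ℤ) := by positivity
  constructor <;> intro ν <;> have := hr ν
  · simp only [loK, bondHiK, Pi.add_apply, Pi.smul_apply, smul_eq_mul, e_apply, mul_ite, mul_one, mul_zero, hP]
    split_ifs <;> constructor <;> linarith
  · simp only [loK, bondHiK, Pi.add_apply, Pi.smul_apply, smul_eq_mul, e_apply, mul_ite, mul_one, mul_zero, hP]
    split_ifs <;> constructor <;> linarith

omit [CompleteSpace 𝔸] in
/-- LOCALITY OF THE LINEAR PART IN THE DIRECTION `X·δ_b`: `(Q_j(1)(X·δ_b))(c) = 0` unless `b ⊂ B^j(c₋) ∪ B^j(c₊)`.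
[cite: Balaban1985Averaging, (127) p.37, p.24] -/
theorem linQIter_bump_eq_zero (L : ℕ) (y : Site d) (μ : Fin d) (X : 𝔸) (j : ℕ) (z : Site d) (κ : Fin d)
    (h : ¬ BondIn (loK L j z) (bondHiK L j z κ) y μ) : linQIter L (bump y μ X) j z κ = 0 := by
  rw [linQIter_eq_linQ_pow, linQ_eq_sum]
  refine Finset.sum_eq_zero fun r _ => ?_
  rw [Finset.sum_eq_zero fun i _ => ?_, smul_zero]
  refine bump_eq_zero_of X fun hyp => h ?_
  obtain ⟨hy, hμ⟩ := hyp
  rw [← hy, hμ]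
  exact bondIn_pow_line L j z μ r i

omit [CompleteSpace 𝔸] in
/-- PER-BOND SIZE OF THE LINEAR PART — (147) at `α₀ = 0` in `B`-variables: `|(Q_j(1)(X·δ_b))(c)| ≤ L^j·L^{−jd}·|X|`
(of the `L^{jd}·L^j` segment bonds entering `(Q_j(1)·)(c)` with weight `L^{−jd}`, at most `L^j` — one per position on
the segment — are the bond `b`).  With `η = L^{−k}`, `j = k` this is `|Q_k(U₀; c, b)| ≤ 1` of (147) via (138).
[cite: Balaban1985Averaging, (147) p.40, (138) p.39] -/
theorem norm_linQIter_bump_le (L : ℕ) (y : Site d) (μ : Fin d) (X : 𝔸) (j : ℕ) (z : Site d) (κ : Fin d) :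
    ‖linQIter L (bump y μ X) j z κ‖ ≤ (L : ℝ) ^ j * (((L : ℝ) ^ j) ^ d)⁻¹ * ‖X‖ := by
  classical
  rw [linQIter_eq_linQ_pow, linQ_eq_sum]
  have hN : ((L ^ j : ℕ) : ℝ) = (L : ℝ) ^ j := by push_cast; rfl
  have hLd : (0 : ℝ) ≤ (((L : ℝ) ^ j) ^ d)⁻¹ := by positivity
  set p : Site d := ((L ^ j : ℕ) : ℤ) • z
  calc ‖∑ r : Fin d → Fin (L ^ j), (((L ^ j : ℕ) : ℝ) ^ d)⁻¹ •
          ∑ i : Fin (L ^ j), bump y μ X (p + boxVec (L ^ j) r + ((i : ℕ) : ℤ) • e κ) κ‖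
      ≤ ∑ r : Fin d → Fin (L ^ j), (((L : ℝ) ^ j) ^ d)⁻¹ *
          ∑ i : Fin (L ^ j), ‖bump y μ X (p + boxVec (L ^ j) r + ((i : ℕ) : ℤ) • e κ) κ‖ := by
        refine (norm_sum_le _ _).trans (Finset.sum_le_sum fun r _ => ?_)
        rw [norm_smul, norm_inv, norm_pow, Real.norm_natCast, hN]
        exact mul_le_mul_of_nonneg_left (norm_sum_le _ _) hLd
    _ = (((L : ℝ) ^ j) ^ d)⁻¹ * ∑ ri : (Fin d → Fin (L ^ j)) × Fin (L ^ j),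
          ‖bump y μ X (p + boxVec (L ^ j) ri.1 + ((ri.2 : ℕ) : ℤ) • e κ) κ‖ := by
        rw [← Finset.mul_sum, Fintype.sum_prod_type]
    _ ≤ (((L : ℝ) ^ j) ^ d)⁻¹ * ((L ^ j : ℕ) * ‖X‖) := by
        refine mul_le_mul_of_nonneg_left ?_ hLd
        refine (sum_le_card_mul_of_zero Finset.univ
          (Finset.univ.filter fun ri : (Fin d → Fin (L ^ j)) × Fin (L ^ j) =>
            p + boxVec (L ^ j) ri.1 + ((ri.2 : ℕ) : ℤ) • e κ = y)
          _ (norm_nonneg X) (fun ri _ => norm_bump_le y μ X _ κ) fun ri _ hri => ?_).trans ?_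
        · rw [norm_eq_zero]
          simp only [Finset.mem_filter, Finset.mem_univ, true_and] at hri
          exact bump_eq_zero_of X fun hyp => hri hyp.1
        · refine mul_le_mul_of_nonneg_right ?_ (norm_nonneg X)
          have hinj : Set.InjOn (fun ri : (Fin d → Fin (L ^ j)) × Fin (L ^ j) => ri.2)
              (Finset.univ.filter fun ri : (Fin d → Fin (L ^ j)) × Fin (L ^ j) =>
                p + boxVec (L ^ j) ri.1 + ((ri.2 : ℕ) : ℤ) • e κ = y) := by
            intro ri hri ri' hri' h2
            simp only [Finset.coe_filter, Finset.mem_univ, true_and, Set.mem_setOf_eq] at hri hri'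
            simp only at h2
            have hb : boxVec (L ^ j) ri.1 = boxVec (L ^ j) ri'.1 := by
              have := hri.trans hri'.symm
              rw [h2] at this
              exact add_left_cancel (add_right_cancel this)
            refine Prod.ext (funext fun ν => Fin.ext ?_) h2
            have := congrFun hb ν
            simpa [boxVec] using this
          have h := Finset.card_le_card_of_injOn _ (fun ri _ => Finset.mem_coe.2 (Finset.mem_univ ri.2)) hinj
          have h' : (Finset.univ.filter fun ri : (Fin d → Fin (L ^ j)) × Fin (L ^ j) =>
              p + boxVec (L ^ j) ri.1 + ((ri.2 : ℕ) : ℤ) • e κ = y).card ≤ L ^ j := by simpa using h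
          exact_mod_cast h'
    _ = (L : ℝ) ^ j * (((L : ℝ) ^ j) ^ d)⁻¹ * ‖X‖ := by rw [hN]; ring

end SingleBond

/-! ## §4 The functional derivative of the remainders `C_j` in the direction `X·δ_b`: the (149)–(155) induction -/

section Induction

variable {𝔸 : Type*} [NormedRing 𝔸] [NormedAlgebra ℂ 𝔸] [CompleteSpace 𝔸]

/-- The remainder `C_j(U₀, A)` of (134) at `U₀ = 1`, in the un-normalised form and `B`-variables of `B7Prop4Flat`:
`C_j = Q_j(1, ·) − Q_j(1)·` (`logIter − linQIter`; with `B = ηA`, `η = L^{−k}`, `j = k` this is exactly `C_k(U₀, A)`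
of (134)/(157), since `L^kη = 1`). [cite: Balaban1985Averaging, (134) p.38, (128) p.37] -/
def CIter (L : ℕ) (B : Site d → Fin d → 𝔸) (j : ℕ) : Site d → Fin d → 𝔸 := logIter L B j - linQIter L B j

/-- `C_j(B)(c) = Q_j(1, B)(c) − (Q_j(1)B)(c)` bondwise (134). [cite: Balaban1985Averaging, (134) p.38] -/
theorem CIter_apply (L : ℕ) (B : Site d → Fin d → 𝔸) (j : ℕ) (z : Site d) (κ : Fin d) :
    CIter L B j z κ = logIter L B j z κ - linQIter L B j z κ := rfl

/-- **THE RECURSION (152) AT `U₀ = 1`**: "C_{j+1}(U₀, A) = LQ(Ū₀^j)C_j(U₀, L^{−1}A) + C(Ū₀^j, L^{−1}Q_j(U₀)A +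
C_j(U₀, L^{−1}A))" — in `B`-variables: `C_{j+1} = C(1, Q_j(1, ·), c) + L·Q₀(C_j)` with `Q_j(1, ·) = Q_j(1)· + C_j` inside
the one-step remainder. [cite: Balaban1985Averaging, (152) p.41] -/
theorem CIter_succ (L : ℕ) (B : Site d → Fin d → 𝔸) (j : ℕ) (z : Site d) (κ : Fin d) :
    CIter L B (j + 1) z κ = oneC L (logIter L B j) ((L : ℤ) • z) κ + linQ L (CIter L B j) ((L : ℤ) • z) κ := by
  rw [CIter_apply, logIter_succ, linQIter_succ, oneC, CIter, linQ_sub]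
  abel

/-- The directional ("functional", (137)) derivative of `B ↦ C_j(B)(c)` at `B` in the direction `δB`:
`dC_j(B; δB) = d/dt C_j(B + tδB)|_{t=0}` (Mathlib `lineDeriv ℂ`). [cite: Balaban1985Averaging, (137) p.39] -/
def dC (L : ℕ) (B D : Site d → Fin d → 𝔸) (j : ℕ) (z : Site d) (κ : Fin d) : 𝔸 :=
  lineDeriv ℂ (fun B' => CIter L B' j z κ) B D

/-- The witness for the printed `C₃` of Prop. 5 (p. 41: "This inequality is satisfied if C₃ > C″₁ and α₀, α₁ are
sufficiently small, e.g., we may take C₃ = 6C″₁"): `C₃(d, L) = 128(d+1)C₁(d)L^d` (per-bond bookkeeping, header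
DIVERGENCES (c)). [cite: Balaban1985Averaging, (155) p.41, Prop. 5 p.42] -/
def C3 (d L : ℕ) : ℝ := 128 * (d + 1) * C1 d * (L : ℝ) ^ d

/-- The per-bond bound of `dC_j` in `B`-variables: `K_j = C₃·(L^j)²·L^{−jd}·b` (`= C₃|A|·η^d` at `j = k`, `b = η|A|`).
[cite: Balaban1985Averaging, (149) p.40, (157) p.42] -/
def K5 (d L : ℕ) (b : ℝ) (j : ℕ) : ℝ := C3 d L * ((L : ℝ) ^ j) ^ 2 * (((L : ℝ) ^ j) ^ d)⁻¹ * b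

/-- `C₃ > 0` ("C₃ is a positive constant", p. 40). [cite: Balaban1985Averaging, (149) p.40] -/
theorem C3_pos (d L : ℕ) (hL : 1 ≤ L) : 0 < C3 d L := by
  have := C1_pos d; have hL0 : 0 < L := hL; unfold C3; positivity

/-- The per-bond size `K_j ≥ 0` — bookkeeping. [folklore] -/
theorem K5_nonneg (d L : ℕ) {b : ℝ} (hb : 0 ≤ b) (j : ℕ) : 0 ≤ K5 d L b j := by
  have := C1_pos d; unfold K5 C3; positivity

/-- `C₃·L^k·b ≤ 1` implies the smallness `32C₁·L^k·b ≤ 1` (so Prop. 4 applies and `2L^jb ≤ ¼c₃` for `j < k`) —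
bookkeeping. [folklore] -/
theorem small32_of_C3 (d L : ℕ) (hL : 1 ≤ L) {t : ℝ} (ht : 0 ≤ t) (h : C3 d L * t ≤ 1) : 32 * C1 d * t ≤ 1 := by
  have hC1 := C1_pos d
  have hL1 : (1 : ℝ) ≤ (L : ℝ) ^ d := one_le_pow₀ (by exact_mod_cast hL)
  have hd : (1 : ℝ) ≤ (d : ℝ) + 1 := by have : (0:ℝ) ≤ d := Nat.cast_nonneg d; linarith
  refine le_trans ?_ h
  unfold C3
  have h1 : C1 d ≤ ((d : ℝ) + 1) * C1 d := le_mul_of_one_le_left hC1.le hd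
  have h2 : ((d : ℝ) + 1) * C1 d ≤ ((d : ℝ) + 1) * C1 d * (L : ℝ) ^ d :=
    le_mul_of_one_le_right (by positivity) hL1
  have : 32 * C1 d ≤ 128 * ((d : ℝ) + 1) * C1 d * (L : ℝ) ^ d := by nlinarith
  exact mul_le_mul_of_nonneg_right this ht

/-- **THE (149) INDUCTION, PER BOND** — p. 40: "We will prove by induction that |⟨(δ/δA) C_j(U₀, A), δA⟩| ≤
C₃|A|Q″_j|δA|, (149) where the configurations A are considered on L^{−j}-lattice and C₃ is a positive constant
satisfying conditions which will be written later."; p. 41, after (152): "Differentiation of the above equality gives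
(153). Using (143), (148), (149) we obtain the following bound: (154). This bound implies the inequality (149) for
j + 1 if (155). This inequality is satisfied if C₃ > C″₁ and α₀, α₁ are sufficiently small, e.g., we may take C₃ = 6C″₁
and α₀, α₁ satisfying 4dC′₁α₀L^{−1} ≤ 1/3, (C₂L^{−1} + 12dC″₁L^{−1})α₁ ≤ 2/3."  AT `U₀ = 1` (base `j = 0`: `C₀ = 0`), in
the direction `δB = X·δ_b` of ONE unit-lattice bond `b = ⟨y, y + e_μ⟩`, for every `j ≤ k` and every bond `c = ⟨z, z+e_κ⟩`
of the `L^j`-lattice: (a) `t ↦ C_j(B + tXδ_b)(c)` is differentiable at `t = 0`; (b) `|dC_j(B; Xδ_b)(c)| ≤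
C₃(L^j)²L^{−jd}·b·|X|` (`sup|B| ≤ b`, `C₃L^kb ≤ 1`); (c) it vanishes unless `b ⊂ B^j(c₋) ∪ B^j(c₊)`.  Step `j → j+1`
= (153) differentiated along the line: chain rule through the finitely many variables of `C(1, ·, c)` (§1), (148) for
the concrete `C` (§2) with `|Q″_{S}δ| ≤ L^{−d}·2d·sup` (at most `2d` level-`j` bonds see `b`, `eq_blockPt_or`), and the
sharp line count `2L − 1` for `L·Q₀(dC_j)` (`norm_linQ_le_of_two_sites`); the numerical inequality replacing (155) is
`(2L−1)/L² + (16dC₁L^d/C₃)(1 + C₃L^jb) ≤ 3/4 + 1/4`. [cite: Balaban1985Averaging, (149)–(155) pp.40–41] -/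
theorem prop5_flat_induction (L : ℕ) (hL : 2 ≤ L) (B : Site d → Fin d → 𝔸) {b : ℝ} (hb : 0 ≤ b)
    (hB : ∀ x κ, ‖B x κ‖ ≤ b) (k : ℕ) (hk : C3 d L * ((L : ℝ) ^ k * b) ≤ 1) (y : Site d) (μ : Fin d) (X : 𝔸) :
    ∀ j ≤ k, ∀ (z : Site d) (κ : Fin d),
      HasLineDerivAt ℂ (fun B' => CIter L B' j z κ) (dC L B (bump y μ X) j z κ) B (bump y μ X) ∧
      ‖dC L B (bump y μ X) j z κ‖ ≤ K5 d L b j * ‖X‖ ∧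
      (¬ BondIn (loK L j z) (bondHiK L j z κ) y μ → dC L B (bump y μ X) j z κ = 0) := by
  classical
  have hL1 : 1 ≤ L := le_trans (by norm_num) hL
  have hL0 : 0 < L := hL1
  have hLr : (2 : ℝ) ≤ L := by exact_mod_cast hL
  have hC1 := C1_pos d
  have hC3 := C3_pos d L hL1
  have ht_mono : ∀ {j : ℕ}, j ≤ k → (L : ℝ) ^ j * b ≤ (L : ℝ) ^ k * b := fun hj =>
    mul_le_mul_of_nonneg_right (pow_le_pow_right₀ (by exact_mod_cast hL1) hj) hb
  have h32 : 32 * C1 d * ((L : ℝ) ^ k * b) ≤ 1 := small32_of_C3 d L hL1 (by positivity) hk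
  have h8 : 8 * C1 d * ((L : ℝ) ^ k * b) ≤ 1 := by nlinarith [hC1, mul_nonneg (pow_nonneg (Nat.cast_nonneg L) k) hb]
  set D := bump y μ X with hD
  intro j
  induction j with
  | zero =>
    intro _ z κ
    have hd0 : dC L B D 0 z κ = 0 := by
      simp [dC, lineDeriv, CIter_apply]
    refine ⟨?_, by rw [hd0, norm_zero]; exact mul_nonneg (K5_nonneg d L hb 0) (norm_nonneg X), fun _ => hd0⟩
    rw [hd0]
    show HasDerivAt (fun t : ℂ => CIter L (B + t • D) 0 z κ) 0 0
    simp only [CIter_apply, logIter_zero, linQIter_zero, sub_self]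
    exact hasDerivAt_const 0 0
  | succ j ihj =>
    intro hjk z κ
    have ih := ihj (Nat.le_of_succ_le hjk)
    -- the data of the step
    set q : Site d := (L : ℤ) • z with hq
    set S := S1 L q κ with hS
    set ρ0 : S → 𝔸 := restr S (logIter L B j) with hρ0
    set f : (S → 𝔸) → 𝔸 := fun a => oneC L (insCfg S a) q κ with hf
    set E : Site d → Fin d → 𝔸 := fun x μ' => dC L B D j x μ' + linQIter L D j x μ' with hE
    -- smallness at level j
    have hjk' : j ≤ k := Nat.le_of_succ_le hjk
    have hPj : ∀ x μ', ‖logIter L B j x μ'‖ ≤ 2 * ((L : ℝ) ^ j * b) := fun x μ' =>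
      ((prop4_flat_induction L hL B hb hB k h8) j hjk').2.2 x μ'
    have htj : 0 ≤ (L : ℝ) ^ j * b := by positivity
    have h2t : 2 * (4 * ((L : ℝ) ^ j * b)) ≤ c3 d L := by
      refine two_mul_le_c3_of_small L hL1 (by positivity) ?_
      calc 8 * C1 d * ((L : ℝ) * (4 * ((L : ℝ) ^ j * b))) = 32 * C1 d * ((L : ℝ) ^ (j + 1) * b) := by ring
        _ ≤ 32 * C1 d * ((L : ℝ) ^ k * b) := mul_le_mul_of_nonneg_left (ht_mono hjk) (by positivity)
        _ ≤ 1 := h32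
    have hc3 := c3_pos d (L := L) hL1
    have hρ0n : ‖ρ0‖ ≤ 2 * ((L : ℝ) ^ j * b) :=
      (pi_norm_le_iff_of_nonneg (by positivity)).2 fun s => hPj _ _
    have hρ0half : ‖ρ0‖ < c3 d L / 2 := by linarith
    have hρ0lt : ∀ s, ‖ρ0 s‖ < c3 d L := fun s => by linarith [norm_le_pi_norm ρ0 s]
    -- differentiability of the one-step remainder on 𝔸^S at ρ0 (Prop. 3)
    have hfan : DifferentiableAt ℂ f ρ0 := ((prop3_flat_C_ins S L hL1 q κ).1 ρ0 hρ0lt).differentiableAt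
    -- the line through the variables of C(1,·,c)
    have hlin : ∀ x μ', HasDerivAt (fun t : ℂ => logIter L (B + t • D) j x μ') (E x μ') 0 := by
      intro x μ'
      have h1 : HasDerivAt (fun t : ℂ => CIter L (B + t • D) j x μ') (dC L B D j x μ') 0 := (ih x μ').1
      have h2 := hasDerivAt_linQIter_line L B D j x μ'
      have h12 := h1.add h2
      refine h12.congr_of_eventuallyEq (Filter.Eventually.of_forall fun t => ?_)
      simp [CIter_apply]
    have hρ : HasDerivAt (fun t : ℂ => restr S (logIter L (B + t • D) j)) (restr S E) 0 :=
      hasDerivAt_pi.2 fun s => hlin s.1.1 s.1.2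
    have hρfun0 : restr S (logIter L (B + (0 : ℂ) • D) j) = ρ0 := by rw [zero_smul, add_zero]
    have hfan0 : DifferentiableAt ℂ f (restr S (logIter L (B + (0 : ℂ) • D) j)) := by rw [hρfun0]; exact hfan
    have hcomp : HasDerivAt (fun t : ℂ => f (restr S (logIter L (B + t • D) j))) (fderiv ℂ f ρ0 (restr S E)) 0 := by
      have := hfan0.hasFDerivAt.comp_hasDerivAt (0 : ℂ) hρ
      rw [hρfun0] at this
      exact this
    have hone : HasDerivAt (fun t : ℂ => oneC L (logIter L (B + t • D) j) q κ) (fderiv ℂ f ρ0 (restr S E)) 0 := by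
      refine hcomp.congr_of_eventuallyEq (Filter.Eventually.of_forall fun t => ?_)
      exact oneC_eq_ins L hL1 _ q κ
    have hlinC : HasDerivAt (fun t : ℂ => linQ L (CIter L (B + t • D) j) q κ) (linQ L (dC L B D j) q κ) 0 :=
      hasDerivAt_linQ_family L q κ fun x => (ih x κ).1
    have htot : HasDerivAt (fun t : ℂ => CIter L (B + t • D) (j + 1) z κ)
        (fderiv ℂ f ρ0 (restr S E) + linQ L (dC L B D j) q κ) 0 := by
      refine (hone.add hlinC).congr_of_eventuallyEq (Filter.Eventually.of_forall fun t => ?_)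
      exact CIter_succ L _ j z κ
    have hval : dC L B D (j + 1) z κ = fderiv ℂ f ρ0 (restr S E) + linQ L (dC L B D j) q κ := htot.deriv
    -- locality of E at level j, and its size
    have hE0 : ∀ x μ', ¬ BondIn (loK L j x) (bondHiK L j x μ') y μ → E x μ' = 0 := fun x μ' hx => by
      show dC L B D j x μ' + linQIter L D j x μ' = 0
      rw [(ih x μ').2.2 hx, hD, linQIter_bump_eq_zero L y μ X j x μ' hx, add_zero]
    have hEle : ∀ x μ', ‖E x μ'‖ ≤ (K5 d L b j + (L : ℝ) ^ j * (((L : ℝ) ^ j) ^ d)⁻¹) * ‖X‖ := fun x μ' => by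
      rw [add_mul]
      exact (norm_add_le _ _).trans (add_le_add (ih x μ').2.1 (norm_linQIter_bump_le L y μ X j x μ'))
    -- (148) for the concrete C at ρ0 in the direction restr S E
    have h148 : ‖fderiv ℂ f ρ0 (restr S E)‖ ≤ C1pp d L * ‖ρ0‖ * Qpp (L : ℝ) d (restr S E) := by
      rw [← dPair_eq_fderiv hfan]
      exact ineq148_flat S L hL1 q κ ρ0 hρ0half (restr S E)
    -- |Q″_S (restr E)| ≤ L^{-d} · 2d · sup|E|
    have hM0 : 0 ≤ (K5 d L b j + (L : ℝ) ^ j * (((L : ℝ) ^ j) ^ d)⁻¹) * ‖X‖ := by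
      have := K5_nonneg d L hb j; positivity
    have hQpp : Qpp (L : ℝ) d (restr S E) ≤
        ((L : ℝ) ^ d)⁻¹ * ((2 * d : ℕ) * ((K5 d L b j + (L : ℝ) ^ j * (((L : ℝ) ^ j) ^ d)⁻¹) * ‖X‖)) := by
      unfold Qpp
      rw [← Finset.mul_sum]
      refine mul_le_mul_of_nonneg_left ?_ (by positivity)
      have hsum : ∑ s : S, ‖restr S E s‖ = ∑ s ∈ S, ‖E s.1 s.2‖ := Finset.sum_coe_sort S (fun s => ‖E s.1 s.2‖)
      rw [hsum]
      refine (sum_le_card_mul_of_zero S (nearBonds (blockPt L j y)) _ hM0 (fun s _ => hEle _ _)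
        fun s _ hs => ?_).trans ?_
      · rw [norm_eq_zero]
        exact hE0 _ _ fun hb' => hs (mem_nearBonds_of_bondIn L hL1 j hb')
      · exact mul_le_mul_of_nonneg_right (by exact_mod_cast card_nearBonds_le (blockPt L j y)) hM0
    -- the sharp bound for L·Q₀(dC_j)
    have hKX : 0 ≤ K5 d L b j * ‖X‖ := mul_nonneg (K5_nonneg d L hb j) (norm_nonneg X)
    have hT1 : ‖linQ L (dC L B D j) q κ‖ ≤ ((L : ℝ) ^ d)⁻¹ * ((2 * L - 1 : ℕ) * (K5 d L b j * ‖X‖)) := by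
      refine norm_linQ_le_of_two_sites L hL1 (dC L B D j) κ hKX (fun x => (ih x κ).2.1) (blockPt L j y)
        (fun x hx1 hx2 => (ih x κ).2.2 fun hb' => ?_) z
      rcases eq_blockPt_or L hL1 j hb'.1 with h | h
      · exact hx1 h
      · exact hx2 h
    refine ⟨hval ▸ htot, ?_, fun hnot => ?_⟩
    · -- the numerical step (154)–(155)
      rw [hval]
      refine (norm_add_le _ _).trans ?_
      have hw : (((L : ℝ) ^ (j + 1)) ^ d)⁻¹ = ((L : ℝ) ^ d)⁻¹ * (((L : ℝ) ^ j) ^ d)⁻¹ := by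
        rw [pow_succ, mul_pow, mul_inv, mul_comm]
      have hLd0 : (0 : ℝ) < (L : ℝ) ^ d := by positivity
      have hLdinv : ((L : ℝ) ^ d) * ((L : ℝ) ^ d)⁻¹ = 1 := mul_inv_cancel₀ hLd0.ne'
      -- T1 ≤ (3/4) K_{j+1}
      have hT1' : ((L : ℝ) ^ d)⁻¹ * ((2 * L - 1 : ℕ) * (K5 d L b j * ‖X‖)) ≤ 3 / 4 * (K5 d L b (j + 1) * ‖X‖) := by
        have hcast : ((2 * L - 1 : ℕ) : ℝ) = 2 * (L : ℝ) - 1 := by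
          rw [Nat.cast_sub (by omega), Nat.cast_mul]; norm_num
        have hq34 : 2 * (L : ℝ) - 1 ≤ 3 / 4 * (L : ℝ) ^ 2 := by nlinarith
        have hZ : 0 ≤ ((L : ℝ) ^ d)⁻¹ * (C3 d L * ((L : ℝ) ^ j) ^ 2 * (((L : ℝ) ^ j) ^ d)⁻¹ * b * ‖X‖) := by positivity
        calc ((L : ℝ) ^ d)⁻¹ * ((2 * L - 1 : ℕ) * (K5 d L b j * ‖X‖))
            = (2 * (L : ℝ) - 1) * (((L : ℝ) ^ d)⁻¹ * (C3 d L * ((L : ℝ) ^ j) ^ 2 * (((L : ℝ) ^ j) ^ d)⁻¹ * b * ‖X‖)) := by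
              rw [hcast, K5]; ring
          _ ≤ 3 / 4 * (L : ℝ) ^ 2 * (((L : ℝ) ^ d)⁻¹ * (C3 d L * ((L : ℝ) ^ j) ^ 2 * (((L : ℝ) ^ j) ^ d)⁻¹ * b * ‖X‖)) :=
              mul_le_mul_of_nonneg_right hq34 hZ
          _ = 3 / 4 * (K5 d L b (j + 1) * ‖X‖) := by rw [K5, hw, pow_succ (L : ℝ) j, mul_pow]; ring
      -- T3 ≤ (1/4) K_{j+1}
      have hT3' : C1pp d L * ‖ρ0‖ * Qpp (L : ℝ) d (restr S E) ≤ 1 / 4 * (K5 d L b (j + 1) * ‖X‖) := by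
        have hC1pp : 0 ≤ C1pp d L := by unfold C1pp; positivity
        have hQ0 : 0 ≤ Qpp (L : ℝ) d (restr S E) := by
          unfold Qpp; exact Finset.sum_nonneg fun s _ => by positivity
        set R : ℝ := (L : ℝ) ^ 2 * ((L : ℝ) ^ j) ^ 2 * (((L : ℝ) ^ j) ^ d)⁻¹ * b * ‖X‖ with hRdef
        have hR : 0 ≤ R := by positivity
        have step1 : C1pp d L * ‖ρ0‖ * Qpp (L : ℝ) d (restr S E) ≤ C1pp d L * (2 * ((L : ℝ) ^ j * b)) *
            (((L : ℝ) ^ d)⁻¹ * ((2 * d : ℕ) * ((K5 d L b j + (L : ℝ) ^ j * (((L : ℝ) ^ j) ^ d)⁻¹) * ‖X‖))) := by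
          gcongr
        have step2 : C1pp d L * (2 * ((L : ℝ) ^ j * b)) *
            (((L : ℝ) ^ d)⁻¹ * ((2 * d : ℕ) * ((K5 d L b j + (L : ℝ) ^ j * (((L : ℝ) ^ j) ^ d)⁻¹) * ‖X‖))) =
            (16 * d * C1 d) * (((L : ℝ) ^ d) * ((L : ℝ) ^ d)⁻¹) * (1 + C3 d L * ((L : ℝ) ^ j * b)) * R := by
          rw [C1pp, K5]; push_cast; ring
        have step3 : (16 * d * C1 d) * (((L : ℝ) ^ d) * ((L : ℝ) ^ d)⁻¹) * (1 + C3 d L * ((L : ℝ) ^ j * b)) * R ≤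
            (32 * ((d : ℝ) + 1) * C1 d) * R := by
          rw [hLdinv, mul_one]
          refine mul_le_mul_of_nonneg_right ?_ hR
          have hB2 : 1 + C3 d L * ((L : ℝ) ^ j * b) ≤ 2 := by
            have := mul_le_mul_of_nonneg_left (ht_mono hjk') hC3.le; linarith
          have hdC : 0 ≤ 16 * (d : ℝ) * C1 d := by positivity
          have h1 : 16 * (d : ℝ) * C1 d * (1 + C3 d L * ((L : ℝ) ^ j * b)) ≤ 16 * (d : ℝ) * C1 d * 2 :=
            mul_le_mul_of_nonneg_left hB2 hdC
          nlinarith [hC1, Nat.cast_nonneg (α := ℝ) d]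
        have step4 : (32 * ((d : ℝ) + 1) * C1 d) * R = 1 / 4 * (K5 d L b (j + 1) * ‖X‖) := by
          have hL0' : (L : ℝ) ≠ 0 := by exact_mod_cast hL0.ne'
          rw [K5, hw, pow_succ (L : ℝ) j, mul_pow, C3, hRdef]
          field_simp
          ring
        calc C1pp d L * ‖ρ0‖ * Qpp (L : ℝ) d (restr S E)
            ≤ _ := step1
          _ = _ := step2
          _ ≤ _ := step3
          _ = _ := step4
      linarith [h148, hT1, hT1', hT3']
    · -- locality at level j+1
      rw [hval]
      have hE' : restr S E = 0 := by
        funext s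
        have hs2 : (s : Site d × Fin d) ∈ bondsIn q (bondHi L q κ) := by
          have h2 := s.2; simp only [hS, S1] at h2; exact h2
        have hs : BondIn q (bondHi L q κ) s.1.1 s.1.2 := mem_bondsIn.1 hs2
        exact hE0 _ _ fun hb' => hnot ⟨inBox_nest L j z κ hs hb'.1, inBox_nest L j z κ hs hb'.2⟩
      have hG' : linQ L (dC L B D j) q κ = 0 := by
        rw [linQ_eq_sum]
        refine Finset.sum_eq_zero fun r _ => ?_
        rw [Finset.sum_eq_zero fun i _ => ?_, smul_zero]
        refine (ih _ κ).2.2 fun hb' => hnot ?_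
        have hs := bondIn_line L z κ r i
        exact ⟨inBox_nest L j z κ hs hb'.1, inBox_nest L j z κ hs hb'.2⟩
      rw [hE', map_zero, hG', add_zero]

end Induction

/-! ## §5 Proposition 5 at `U₀ = 1`: (157) and (156) per bond, in `B`-variables and in the printed `A`-variables -/

section Prop5

variable {𝔸 : Type*} [NormedRing 𝔸] [NormedAlgebra ℂ 𝔸] [CompleteSpace 𝔸]

/-- **(157) AT `U₀ = 1`, `B`-VARIABLES** (un-normalised, unit lattice; `sup_b |B_b| ≤ b`, `C₃L^kb ≤ 1`, `L ≥ 2`): for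
every unit-lattice bond `b₀ = ⟨y, y+e_μ⟩`, every `X ∈ 𝔸` and every bond `c` of the `L^k`-lattice, `B′ ↦ C_k(B′)(c)` has
a directional derivative at `B` in the direction `X·δ_{b₀}` ((137): `d/dt C_k(B + tXδ_{b₀})(c)|_{t=0}`, `t ∈ ℂ`), of norm
`≤ C₃·(L^k)²·L^{−kd}·b·|X|`, and it vanishes unless `b₀ ⊂ B^k(c₋) ∪ B^k(c₊)`. [cite: Balaban1985Averaging, Prop. 5 (157) p.42, (137)–(138) p.39, (149) p.40] -/
theorem prop5_flat_157_B (L : ℕ) (hL : 2 ≤ L) (B : Site d → Fin d → 𝔸) {b : ℝ} (hb : 0 ≤ b)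
    (hB : ∀ x κ, ‖B x κ‖ ≤ b) (k : ℕ) (hk : C3 d L * ((L : ℝ) ^ k * b) ≤ 1) (y : Site d) (μ : Fin d) (X : 𝔸)
    (z : Site d) (κ : Fin d) :
    HasLineDerivAt ℂ (fun B' => CIter L B' k z κ) (dC L B (bump y μ X) k z κ) B (bump y μ X) ∧
      ‖dC L B (bump y μ X) k z κ‖ ≤ K5 d L b k * ‖X‖ ∧
      (¬ BondIn (loK L k z) (bondHiK L k z κ) y μ → dC L B (bump y μ X) k z κ = 0) :=
  prop5_flat_induction L hL B hb hB k hk y μ X k le_rfl z κ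

/-- **(156) AT `U₀ = 1`, `B`-VARIABLES**: `B′ ↦ Q_k(1, B′)(c)` has the directional derivative
`dC_k(B; Xδ_{b₀})(c) + (Q_k(1)(Xδ_{b₀}))(c)` at `B` in the direction `X·δ_{b₀}`, of norm
`≤ (L^k·L^{−kd} + C₃(L^k)²L^{−kd}b)·|X|` — (156) = (147) + (157) via (134) (p. 40: "It is enough to prove it for
C_k"), with `α₀ = 0`. [cite: Balaban1985Averaging, Prop. 5 (156) p.42, (146)–(147) p.40, (134) p.38] -/
theorem prop5_flat_156_B (L : ℕ) (hL : 2 ≤ L) (B : Site d → Fin d → 𝔸) {b : ℝ} (hb : 0 ≤ b)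
    (hB : ∀ x κ, ‖B x κ‖ ≤ b) (k : ℕ) (hk : C3 d L * ((L : ℝ) ^ k * b) ≤ 1) (y : Site d) (μ : Fin d) (X : 𝔸)
    (z : Site d) (κ : Fin d) :
    HasLineDerivAt ℂ (fun B' => logIter L B' k z κ) (dC L B (bump y μ X) k z κ + linQIter L (bump y μ X) k z κ)
        B (bump y μ X) ∧
      ‖dC L B (bump y μ X) k z κ + linQIter L (bump y μ X) k z κ‖ ≤
        ((L : ℝ) ^ k * (((L : ℝ) ^ k) ^ d)⁻¹ + K5 d L b k) * ‖X‖ := by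
  obtain ⟨h1, h2, -⟩ := prop5_flat_157_B L hL B hb hB k hk y μ X z κ
  refine ⟨?_, (norm_add_le _ _).trans ?_⟩
  · have h1' : HasDerivAt (fun t : ℂ => CIter L (B + t • bump y μ X) k z κ) (dC L B (bump y μ X) k z κ) 0 := h1
    have h12 := h1'.add (hasDerivAt_linQIter_line L B (bump y μ X) k z κ)
    show HasDerivAt (fun t : ℂ => logIter L (B + t • bump y μ X) k z κ) _ 0
    refine h12.congr_of_eventuallyEq (Filter.Eventually.of_forall fun t => ?_)
    simp [CIter_apply]
  · rw [add_mul, add_comm ((L : ℝ) ^ k * (((L : ℝ) ^ k) ^ d)⁻¹ * ‖X‖)]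
    exact add_le_add h2 (norm_linQIter_bump_le L y μ X k z κ)

omit [CompleteSpace 𝔸] in
/-- `t(ηδA)`-bookkeeping: along the line `A + tδA` the rescaled field is `ηA + t(ηδA)`. [folklore] -/
theorem smul_line (η : ℝ) (A D : Site d → Fin d → 𝔸) (t : ℂ) : η • (A + t • D) = η • A + t • (η • D) := by
  rw [smul_add, smul_comm]

omit [CompleteSpace 𝔸] in
/-- `‖ηX‖ = η‖X‖` for `η ≥ 0` — bookkeeping. [folklore] -/
theorem norm_real_smul (η : ℝ) (hη : 0 ≤ η) (X : 𝔸) : ‖η • X‖ = η * ‖X‖ := by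
  rw [norm_smul, Real.norm_of_nonneg hη]

/-- **PROPOSITION 5 AT `U₀ = 1` — (157) IN THE PRINTED VARIABLES.**  p. 42: "|δ/δA_b C_k(U₀, A, c)| ≤ C₃|A| < C₃α₁
(157)."  Here `A` is a field on the `η = L^{−k}`-lattice (sites still labelled by `ℤ^d`) with `|A| = sup_b |A_b| ≤ a`,
`C₃(d, L)·a ≤ 1` (print: "for α₀, α₁ sufficiently small"), `C_k(U₀, A)(c) = Q_k(U₀, ηA)(c) − (Q_k(U₀)A)(c)` (134)
(`= CIter L (ηA) k`, `L^kη = 1`), and the derivative is taken in the direction `X·δ_b` of one bond `b = ⟨y, y+e_μ⟩`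
((137), `t ∈ ℂ`): it exists and `|dC_k(U₀, A; Xδ_b)(c)| ≤ C₃|A|·η^d|X|`, i.e. `|δ/δA_b C_k(U₀, A, c)| ≤ C₃|A|` in the
normalisation (138) ("partial derivatives multiplied by η^{−d}"). [cite: Balaban1985Averaging, Prop. 5 (157) p.42, (134) p.38, (137)–(138) p.39] -/
theorem prop5_flat_157 (L : ℕ) (hL : 2 ≤ L) (k : ℕ) (A : Site d → Fin d → 𝔸) {a : ℝ} (ha : 0 ≤ a)
    (hA : ∀ x κ, ‖A x κ‖ ≤ a) (hak : C3 d L * a ≤ 1) (y : Site d) (μ : Fin d) (X : 𝔸) (z : Site d) (κ : Fin d) :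
    HasLineDerivAt ℂ (fun A' => CIter L ((((L : ℝ) ^ k)⁻¹) • A') k z κ)
        (dC L ((((L : ℝ) ^ k)⁻¹) • A) (bump y μ ((((L : ℝ) ^ k)⁻¹) • X)) k z κ) A (bump y μ X) ∧
      ‖dC L ((((L : ℝ) ^ k)⁻¹) • A) (bump y μ ((((L : ℝ) ^ k)⁻¹) • X)) k z κ‖ ≤
        C3 d L * a * ((((L : ℝ) ^ k)⁻¹) ^ d * ‖X‖) := by
  have hL1 : 1 ≤ L := le_trans (by norm_num) hL
  have hL0 : (0 : ℝ) < L := by exact_mod_cast (show 0 < L from hL1)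
  set η : ℝ := ((L : ℝ) ^ k)⁻¹ with hη
  have hη0 : 0 < η := by positivity
  have hLη : (L : ℝ) ^ k * η = 1 := mul_inv_cancel₀ (by positivity)
  have hB : ∀ x κ', ‖(η • A) x κ'‖ ≤ η * a := fun x κ' => by
    rw [Pi.smul_apply, Pi.smul_apply, norm_real_smul η hη0.le]
    exact mul_le_mul_of_nonneg_left (hA x κ') hη0.le
  have hk : C3 d L * ((L : ℝ) ^ k * (η * a)) ≤ 1 := by
    have h1 : (L : ℝ) ^ k * (η * a) = a := by rw [← mul_assoc, hLη, one_mul]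
    rw [h1]; exact hak
  obtain ⟨h1, h2, -⟩ := prop5_flat_157_B L hL (η • A) (by positivity) hB k hk y μ (η • X) z κ
  refine ⟨?_, h2.trans (le_of_eq ?_)⟩
  · have h1' : HasDerivAt (fun t : ℂ => CIter L (η • A + t • bump y μ (η • X)) k z κ)
        (dC L (η • A) (bump y μ (η • X)) k z κ) 0 := h1
    show HasDerivAt (fun t : ℂ => CIter L (η • (A + t • bump y μ X)) k z κ) _ 0
    refine h1'.congr_of_eventuallyEq (Filter.Eventually.of_forall fun t => ?_)
    simp only [smul_line, smul_bump]
  · rw [norm_real_smul η hη0.le, K5, ← inv_pow, ← hη]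
    have : (L : ℝ) ^ k * η = 1 := hLη
    calc C3 d L * ((L : ℝ) ^ k) ^ 2 * η ^ d * (η * a) * (η * ‖X‖)
        = C3 d L * a * (η ^ d * ‖X‖) * ((L : ℝ) ^ k * η) ^ 2 := by ring
      _ = C3 d L * a * (η ^ d * ‖X‖) := by rw [this, one_pow, mul_one]

/-- **PROPOSITION 5 AT `U₀ = 1` — (156) IN THE PRINTED VARIABLES.**  p. 42: "The functional derivative of Q_k(U₀, ηA)
is a bounded function for α₀, α₁ sufficiently small, and we have the bounds |δ/δA_b Q_k(U₀, ηA, c)| ≤ 1 + 2C′₁α₀ +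
C₃|A| < 1 + 2C′₁α₀ + C₃α₁ (156)."  At `U₀ = 1` (`α₀ = 0`): for `|A| ≤ a`, `C₃(d, L)·a ≤ 1`, `L ≥ 2`, every bond `b =
⟨y, y + e_μ⟩`, `X ∈ 𝔸` and every bond `c ⊂ Ω^{(k)}` (`L^kη = 1`), `A ↦ Q_k(U₀, ηA)(c)` (the composite (127),
`logIter L (ηA) k`) is differentiable in the direction `X·δ_b` and `|dQ_k(U₀, ηA; Xδ_b)(c)| ≤ (1 + C₃|A|)·η^d|X|`, i.e.
`|δ/δA_b Q_k(U₀, ηA, c)| ≤ 1 + C₃|A|` in the normalisation (138). [cite: Balaban1985Averaging, Prop. 5 (156) p.42, (127) p.37, (137)–(138) p.39, (146)–(147) p.40] -/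
theorem prop5_flat_156 (L : ℕ) (hL : 2 ≤ L) (k : ℕ) (A : Site d → Fin d → 𝔸) {a : ℝ} (ha : 0 ≤ a)
    (hA : ∀ x κ, ‖A x κ‖ ≤ a) (hak : C3 d L * a ≤ 1) (y : Site d) (μ : Fin d) (X : 𝔸) (z : Site d) (κ : Fin d) :
    LineDifferentiableAt ℂ (fun A' => logIter L ((((L : ℝ) ^ k)⁻¹) • A') k z κ) A (bump y μ X) ∧
      ‖lineDeriv ℂ (fun A' => logIter L ((((L : ℝ) ^ k)⁻¹) • A') k z κ) A (bump y μ X)‖ ≤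
        (1 + C3 d L * a) * ((((L : ℝ) ^ k)⁻¹) ^ d * ‖X‖) := by
  have hL1 : 1 ≤ L := le_trans (by norm_num) hL
  have hL0 : (0 : ℝ) < L := by exact_mod_cast (show 0 < L from hL1)
  set η : ℝ := ((L : ℝ) ^ k)⁻¹ with hη
  have hη0 : 0 < η := by positivity
  have hLη : (L : ℝ) ^ k * η = 1 := mul_inv_cancel₀ (by positivity)
  have hB : ∀ x κ', ‖(η • A) x κ'‖ ≤ η * a := fun x κ' => by
    rw [Pi.smul_apply, Pi.smul_apply, norm_real_smul η hη0.le]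
    exact mul_le_mul_of_nonneg_left (hA x κ') hη0.le
  have hk : C3 d L * ((L : ℝ) ^ k * (η * a)) ≤ 1 := by
    have h1 : (L : ℝ) ^ k * (η * a) = a := by rw [← mul_assoc, hLη, one_mul]
    rw [h1]; exact hak
  obtain ⟨h1, h2⟩ := prop5_flat_156_B L hL (η • A) (by positivity) hB k hk y μ (η • X) z κ
  have h1' : HasDerivAt (fun t : ℂ => logIter L (η • A + t • bump y μ (η • X)) k z κ)
      (dC L (η • A) (bump y μ (η • X)) k z κ + linQIter L (bump y μ (η • X)) k z κ) 0 := h1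
  have hA' : HasLineDerivAt ℂ (fun A' => logIter L (η • A') k z κ)
      (dC L (η • A) (bump y μ (η • X)) k z κ + linQIter L (bump y μ (η • X)) k z κ) A (bump y μ X) := by
    show HasDerivAt (fun t : ℂ => logIter L (η • (A + t • bump y μ X)) k z κ) _ 0
    refine h1'.congr_of_eventuallyEq (Filter.Eventually.of_forall fun t => ?_)
    simp only [smul_line, smul_bump]
  refine ⟨hA'.lineDifferentiableAt, ?_⟩
  rw [hA'.lineDeriv]
  refine h2.trans (le_of_eq ?_)
  rw [norm_real_smul η hη0.le, K5, ← inv_pow, ← hη]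
  have : (L : ℝ) ^ k * η = 1 := hLη
  calc ((L : ℝ) ^ k * η ^ d + C3 d L * ((L : ℝ) ^ k) ^ 2 * η ^ d * (η * a)) * (η * ‖X‖)
      = (((L : ℝ) ^ k * η) + C3 d L * a * ((L : ℝ) ^ k * η) ^ 2) * (η ^ d * ‖X‖) := by ring
    _ = (1 + C3 d L * a) * (η ^ d * ‖X‖) := by rw [this, one_pow, mul_one]

/-- LOCALITY OF THE FUNCTIONAL DERIVATIVE (Prop. 4 p. 38: `Q_k(U₀, ηA, c)` "is an analytic function of the variables
A_b, b ⊂ B^k(c₋)∪B^k(c₊)"; (141) p. 39): `δ/δA_b C_k(U₀, A, c) = 0` unless `b ⊂ B^k(c₋) ∪ B^k(c₊)` — at `U₀ = 1`,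
printed variables. [cite: Balaban1985Averaging, p.24 (after (43)), Prop. 4 p.38, (141) p.39, (157) p.42] -/
theorem prop5_flat_157_local (L : ℕ) (hL : 2 ≤ L) (k : ℕ) (A : Site d → Fin d → 𝔸) {a : ℝ} (ha : 0 ≤ a)
    (hA : ∀ x κ, ‖A x κ‖ ≤ a) (hak : C3 d L * a ≤ 1) (y : Site d) (μ : Fin d) (X : 𝔸) (z : Site d) (κ : Fin d)
    (hb : ¬ BondIn (loK L k z) (bondHiK L k z κ) y μ) :
    lineDeriv ℂ (fun A' => CIter L ((((L : ℝ) ^ k)⁻¹) • A') k z κ) A (bump y μ X) = 0 := by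
  have hL1 : 1 ≤ L := le_trans (by norm_num) hL
  have hL0 : (0 : ℝ) < L := by exact_mod_cast (show 0 < L from hL1)
  set η : ℝ := ((L : ℝ) ^ k)⁻¹ with hη
  have hη0 : 0 < η := by positivity
  have hLη : (L : ℝ) ^ k * η = 1 := mul_inv_cancel₀ (by positivity)
  have hB : ∀ x κ', ‖(η • A) x κ'‖ ≤ η * a := fun x κ' => by
    rw [Pi.smul_apply, Pi.smul_apply, norm_real_smul η hη0.le]
    exact mul_le_mul_of_nonneg_left (hA x κ') hη0.le
  have hk : C3 d L * ((L : ℝ) ^ k * (η * a)) ≤ 1 := by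
    have h1 : (L : ℝ) ^ k * (η * a) = a := by rw [← mul_assoc, hLη, one_mul]
    rw [h1]; exact hak
  obtain ⟨h1, -⟩ := prop5_flat_157 L hL k A ha hA hak y μ X z κ
  rw [h1.lineDeriv]
  exact (prop5_flat_157_B L hL (η • A) (by positivity) hB k hk y μ (η • X) z κ).2.2 hb

end Prop5

end Literature.MathematicalPhysics.QuantumFieldTheory.Balaban1983to89.B7Prop5Flat
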